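import Literature.NumberTheory.Sieve.GoldbachLinnikRomanovCertSound1
import Literature.NumberTheory.Sieve.GoldbachLinnikRomanovCertCheckCert
import Literature.NumberTheory.Sieve.GoldbachLinnikRomanovCertCheckCof1
import Literature.NumberTheory.Sieve.GoldbachLinnikRomanovCertCheckCof2
import Literature.NumberTheory.Sieve.GoldbachLinnikRomanovCertCheckCof3
import Literature.NumberTheory.Sieve.GoldbachLinnikRomanovCertCheckCof4
import Literature.NumberTheory.Sieve.GoldbachLinnikRomanovCertCheckCof5
import Literature.NumberTheory.Sieve.GoldbachLinnikRomanovCertCheckHead1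
import Literature.NumberTheory.Sieve.GoldbachLinnikRomanovCertCheckHead2
import Literature.NumberTheory.Sieve.GoldbachLinnikRomanovCertCheckHead3
import Literature.NumberTheory.Sieve.GoldbachLinnikRomanovCertCheckHead4
import Literature.NumberTheory.Sieve.GoldbachLinnikRomanovCertCheckHead5
import Literature.NumberTheory.Sieve.GoldbachLinnikRomanovCertCheckHead6
import Literature.NumberTheory.Sieve.GoldbachLinnikRomanovCertCheckHead7

/-!
# Romanov's constant: `R₀ ≤ 1.94`, unconditionally — soundness II and assembly

Soundness of the certificate, continued from `GoldbachLinnikRomanovCertSound1.lean` (generic records `recs`):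
§6 the objects (`F`, `CsetT`, `H_F`, the kernel leaf data in closed form, the per-`d` roundings `termT_le`,
`termI_le`, `termS_ge`), §7 the unlisted primes: `P₀ ≤ p` (cofactor check + `ChainTableFacts.tableOK`), at most
`⌊(e−1)/22⌋` of them, all `≡ 1 (mod s_e)`, whence `Σ 1/(p−2) ≤ W_e⁺/2^60` and the inflation bound
`Infl(n) − 1 ≤ X_n/(2^60 − X_n)`, §8 the refined majorant `E(x) ≤ Φ_x(C,1) + Σ_{n≤x} H_F(n)(Infl(n) − 1)`
(`sum_filter_le_refined`), §9 Abel summation and Möbius inversion over the order classes (`head_le`), §10 the far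
range of `GoldbachLinnikRomanovConstBound` and `romanovConst_le_of_cert` (certificate ⇒ `R₀ ≤ 1.94`);
§11 the assembly on the certified records of `GoldbachLinnikRomanovCertData1/2.lean` with the kernel facts of `GoldbachLinnikRomanovCertCheck*.lean`:
`romanovConst ≤ 1.94` (print: `1.936 < R₀ < 1.94`, [PintzRuzsa2003, (8.14)]; [HeathbrownPuchta2002, §5]).
This discharges the hypothesis `hR₀ : romanovConst ≤ 1.94` of the `K = 7` / `K = 8` frames of the
Goldbach–Linnik files.  Numerically: head `(T⁺ − T⁻ + I)/2^60 − (S⁺ − S⁻)/2^75 = 1.93722…`, far range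
`A₁ · T(15) = 0.0011857`, total `1.93841 ≤ 1.94`.

References: D. R. Heath-Brown, J.-C. Puchta, *Integers represented as a sum of primes and powers of two*,
Asian J. Math. 6 (2002) [HeathbrownPuchta2002] (§5: the quantity `R₀ = Σ_t f₁(t)/ξ(t)` and its numerical treatment);
J. Pintz, I. Z. Ruzsa, *On Linnik's approximation to Goldbach's problem, I*, Acta Arith. 109 (2003), 169–194
[PintzRuzsa2003] ((8.14): `1.936 < R₀ < 1.94` in print).
-/

namespace Literature.NumberTheory.Sieve.RomanovCert

open Literature.NumberTheory.Sieve.Romanov GoldbachLinnik SingularSeriesMean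

/-! ## §6 The objects of the certificate; the kernel data in closed form -/


/-- The listed primes of order `e`. [folklore] -/
def F (recs : List (ℕ × List ℕ)) (e : ℕ) : Finset ℕ := (leafQs (mkTree recs) e).toFinset

/-- All listed primes (orders `< 2^15`).  (Defined through a list so that a `whnf` of
`q ∈ CsetT recs` is shallow; `Finset.range (2^15)` under `biUnion` would unfold `2^15` deep.) [folklore] -/
def CsetT (recs : List (ℕ × List ℕ)) : Finset ℕ :=
  ((List.range MM).flatMap fun e => leafQs (mkTree recs) e).toFinset

/-- Membership in `CsetT`. [folklore] -/
theorem mem_CsetT {recs : List (ℕ × List ℕ)} {q : ℕ} : q ∈ CsetT recs ↔ ∃ e, e < 32768 ∧ q ∈ F recs e := by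
  simp only [CsetT, F, List.mem_toFinset, List.mem_flatMap, List.mem_range, MM]

/-- The listed primes whose order divides `n`. [folklore] -/
def Cn (recs : List (ℕ × List ℕ)) (n : ℕ) : Finset ℕ := n.divisors.biUnion (F recs)

/-- `H_F(n) = ∏_{q listed, ord_q 2 ∣ n} (1 + 1/(q − 2))`. [folklore] -/
noncomputable def HF (recs : List (ℕ × List ℕ)) (n : ℕ) : ℝ :=
  ∏ q ∈ Cn recs n, (1 + 1 / ((q : ℝ) - 2))

/-- `ord_2(2) = 0` (`2` is not a unit mod `2`). [folklore] -/
theorem ordTwo_two : ordTwo 2 = 0 := by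
  unfold ordTwo
  rw [orderOf_eq_zero_iff']
  intro n hn
  have : (2 : ZMod 2) = 0 := by decide
  rw [this, zero_pow hn.ne']
  exact zero_ne_one

/-- Listed primes: prime, `> 2`, of order exactly `e ≥ 2`. [folklore] -/
theorem mem_F {recs : List (ℕ × List ℕ)} (h : certAll recs = true) {e q : ℕ} (he : e < 32768)
    (hq : q ∈ F recs e) : q.Prime ∧ 2 < q ∧ ordTwo q = e ∧ 2 ≤ e := by
  rw [F, List.mem_toFinset] at hq
  obtain ⟨h1, -, h3⟩ := certAll_sound h he
  obtain ⟨hp, ho⟩ := h1 q hq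
  have h2e : 2 ≤ e := h3 (List.ne_nil_of_mem hq)
  refine ⟨hp, ?_, ho, h2e⟩
  by_contra hle
  have hq2 : q = 2 := le_antisymm (not_lt.1 hle) hp.two_le
  subst hq2
  rw [ordTwo_two] at ho
  omega

/-- `F e = ∅` for `e ≤ 1`. [folklore] -/
theorem F_eq_empty {recs : List (ℕ × List ℕ)} (h : certAll recs = true) {e : ℕ} (he : e ≤ 1) :
    F recs e = ∅ := by
  rw [Finset.eq_empty_iff_forall_notMem]
  intro q hq
  have := (mem_F h (by omega) hq).2.2.2
  omega

/-- The listed primes form a `PrimeSet`. [folklore] -/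
theorem primeSet_CsetT {recs : List (ℕ × List ℕ)} (h : certAll recs = true) :
    PrimeSet (CsetT recs) := by
  intro q hq
  obtain ⟨e, he, hqe⟩ := mem_CsetT.1 hq
  exact ⟨(mem_F h he hqe).1, (mem_F h he hqe).2.1⟩

/-- Distinct orders have disjoint lists. [folklore] -/
theorem F_disjoint {recs : List (ℕ × List ℕ)} (h : certAll recs = true) {e e' : ℕ} (he : e < 32768)
    (he' : e' < 32768) (hne : e ≠ e') : Disjoint (F recs e) (F recs e') := by
  rw [Finset.disjoint_left]
  intro q h1 h2
  exact hne ((mem_F h he h1).2.2.1.symm.trans (mem_F h he' h2).2.2.1)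

/-- Members of `Cn n` (`n < 2^15`). [folklore] -/
theorem mem_Cn {recs : List (ℕ × List ℕ)} (h : certAll recs = true) {n q : ℕ} (hn : n < 32768)
    (hq : q ∈ Cn recs n) : q.Prime ∧ 2 < q ∧ ordTwo q ∣ n ∧ q ∈ CsetT recs := by
  rw [Cn, Finset.mem_biUnion] at hq
  obtain ⟨e, he, hqe⟩ := hq
  have hen : e ≤ n := Nat.divisor_le he
  have hm := mem_F h (by omega) hqe
  exact ⟨hm.1, hm.2.1, hm.2.2.1 ▸ Nat.dvd_of_mem_divisors he, mem_CsetT.2 ⟨e, by omega, hqe⟩⟩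

/-- `H_F(n) ≥ 0`. [folklore] -/
theorem HF_nonneg {recs : List (ℕ × List ℕ)} (h : certAll recs = true) {n : ℕ} (hn : n < 32768) :
    0 ≤ HF recs n :=
  Finset.prod_nonneg fun q hq => by
    have : (2 : ℝ) < q := by exact_mod_cast (mem_Cn h hn hq).2.1
    have : 0 < (q : ℝ) - 2 := by linarith
    positivity

/-- `H_F(n) ≥ 1`. [folklore] -/
theorem one_le_HF {recs : List (ℕ × List ℕ)} (h : certAll recs = true) {n : ℕ} (hn : n < 32768) :
    1 ≤ HF recs n := by
  rw [HF, ← Finset.prod_const_one (s := Cn recs n)]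
  refine Finset.prod_le_prod (fun _ _ => zero_le_one) fun q hq => ?_
  rw [Finset.prod_const_one]
  have : (2 : ℝ) < q := by exact_mod_cast (mem_Cn h hn hq).2.1
  have : 0 < (q : ℝ) - 2 := by linarith
  have : 0 ≤ 1 / ((q : ℝ) - 2) := by positivity
  linarith

/-- Cast of `prodSub 1`. [folklore] -/
theorem cast_prodSub_one {l : List ℕ} (hl : ∀ q ∈ l, 2 < q) :
    ((prodSub 1 l : ℕ) : ℝ) = (l.map fun q : ℕ => ((q : ℝ) - 1)).prod := by
  induction l with
  | nil => simp [prodSub]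
  | cons q t ih =>
    have hq := hl q (by simp)
    rw [prodSub, Nat.cast_mul, ih (fun r hr => hl r (by simp [hr])), List.map_cons, List.prod_cons,
      Nat.cast_sub (by omega)]
    simp

/-- Cast of `prodSub 2`. [folklore] -/
theorem cast_prodSub_two {l : List ℕ} (hl : ∀ q ∈ l, 2 < q) :
    ((prodSub 2 l : ℕ) : ℝ) = (l.map fun q : ℕ => ((q : ℝ) - 2)).prod := by
  induction l with
  | nil => simp [prodSub]
  | cons q t ih =>
    have hq := hl q (by simp)
    rw [prodSub, Nat.cast_mul, ih (fun r hr => hl r (by simp [hr])), List.map_cons, List.prod_cons,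
      Nat.cast_sub (by omega)]
    simp

/-- `prodSub 2 > 0` on lists of numbers `> 2`. [folklore] -/
theorem prodSub_two_pos {l : List ℕ} (hl : ∀ q ∈ l, 2 < q) : 0 < prodSub 2 l := by
  induction l with
  | nil => simp [prodSub]
  | cons q t ih =>
    have hq := hl q (by simp)
    rw [prodSub]
    exact Nat.mul_pos (by omega) (ih fun r hr => hl r (by simp [hr]))

/-- The per-order products over `F e` are the cached `prodSub` values. [folklore] -/
theorem prod_F_eq_prodSub {recs : List (ℕ × List ℕ)} (h : certAll recs = true) {e : ℕ} (he : e < 32768) :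
    (∏ q ∈ F recs e, ((q : ℝ) - 1)) = ((prodSub 1 (leafQs (mkTree recs) e) : ℕ) : ℝ) ∧
    (∏ q ∈ F recs e, ((q : ℝ) - 2)) = ((prodSub 2 (leafQs (mkTree recs) e) : ℕ) : ℝ) := by
  obtain ⟨-, h2, -⟩ := certAll_sound h he
  have hnd : (leafQs (mkTree recs) e).Nodup := h2.nodup
  have hgt : ∀ q ∈ leafQs (mkTree recs) e, 2 < q := fun q hq =>
    (mem_F h he (List.mem_toFinset.2 hq)).2.1
  refine ⟨?_, ?_⟩
  · rw [F, List.prod_toFinset _ hnd, cast_prodSub_one hgt]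
  · rw [F, List.prod_toFinset _ hnd, cast_prodSub_two hgt]

/-- `H_F(n) = (∏_{e ∣ n} ∏_{q ∈ F_e}(q−1)) / (∏_{e ∣ n} ∏_{q ∈ F_e}(q−2))`. [folklore] -/
theorem HF_eq_div {recs : List (ℕ × List ℕ)} (h : certAll recs = true) {n : ℕ} (hn : n < 32768) :
    HF recs n = (∏ e ∈ n.divisors, ((prodSub 1 (leafQs (mkTree recs) e) : ℕ) : ℝ)) /
      (∏ e ∈ n.divisors, ((prodSub 2 (leafQs (mkTree recs) e) : ℕ) : ℝ)) := by
  have hdiv : ∀ e ∈ n.divisors, e < 32768 := fun e he => lt_of_le_of_lt (Nat.divisor_le he) hn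
  rw [HF, Cn, Finset.prod_biUnion]
  · rw [← Finset.prod_div_distrib]
    refine Finset.prod_congr rfl fun e he => ?_
    obtain ⟨h1, h2⟩ := prod_F_eq_prodSub h (hdiv e he)
    rw [← h1, ← h2, ← Finset.prod_div_distrib]
    refine Finset.prod_congr rfl fun q hq => ?_
    have hq2 : (2 : ℝ) < q := by exact_mod_cast (mem_F h (hdiv e he) hq).2.1
    have : (q : ℝ) - 2 ≠ 0 := by linarith
    field_simp
    ring
  · intro e he e' he' hne
    exact F_disjoint h (hdiv e he) (hdiv e' he') hne

/-- The per-`d` kernel data in closed form: `X_d = Σ_{e ∣ d} W_e`, `Hn_d = ∏_{e∣d} ∏(q−1)`,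
`Hd_d = ∏_{e∣d} ∏(q−2)`. [folklore] -/
theorem dData_eq (recs : List (ℕ × List ℕ)) {d : ℕ} (hd0 : 0 < d) (hd : d < 32768) :
    dData (mkTree recs) d = (∑ e ∈ d.divisors, wOf e,
      ∏ e ∈ d.divisors, prodSub 1 (leafQs (mkTree recs) e),
      ∏ e ∈ d.divisors, prodSub 2 (leafQs (mkTree recs) e)) := by
  have hnd := nodup_divsOf_facSm hd0 (by omega : d < 182 * 182)
  have hfs := toFinset_divsOf hd0 (by omega : d < 182 * 182)
  have hmem : ∀ e ∈ divsOf (facSm smallPrimes d), e < 32768 := by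
    intro e he
    have : e ∈ d.divisors := by rw [← hfs]; exact List.mem_toFinset.2 he
    exact lt_of_le_of_lt (Nat.divisor_le this) hd
  rw [dData, accDivs_eq]
  simp only [zero_add, one_mul]
  rw [← hfs, List.sum_toFinset _ hnd, List.prod_toFinset _ hnd, List.prod_toFinset _ hnd]
  refine Prod.ext ?_ (Prod.ext ?_ ?_)
  · exact congrArg List.sum (List.map_congr_left fun e he => (look_mkTree recs (hmem e he)).1)
  · exact congrArg List.prod (List.map_congr_left fun e he => (look_mkTree recs (hmem e he)).2.1)
  · exact congrArg List.prod (List.map_congr_left fun e he => (look_mkTree recs (hmem e he)).2.2)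

/-- `H_F(d) = Hn_d / Hd_d` with `Hd_d > 0`. [folklore] -/
theorem HF_eq_dData {recs : List (ℕ × List ℕ)} (h : certAll recs = true) {d : ℕ} (hd0 : 0 < d)
    (hd : d < 32768) :
    HF recs d = (((dData (mkTree recs) d).2.1 : ℕ) : ℝ) / (((dData (mkTree recs) d).2.2 : ℕ) : ℝ) ∧
      0 < (dData (mkTree recs) d).2.2 := by
  rw [dData_eq recs hd0 hd, HF_eq_div h hd]
  push_cast
  refine ⟨rfl, Finset.prod_pos fun e he => prodSub_two_pos fun q hq => ?_⟩
  exact (mem_F h (lt_of_le_of_lt (Nat.divisor_le he) hd) (List.mem_toFinset.2 hq)).2.1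

/-! ### The Möbius prefix sums -/

/-- `m(y) = Σ_{k ≤ y} μ(k)/k`. [folklore] -/
noncomputable def mFun (y : ℕ) : ℝ := ∑ k ∈ Finset.Icc 1 y, (ArithmeticFunction.moebius k : ℝ) / k

/-- `M(y) = Σ_{k ≤ y} μ(k)` (Mertens function). [folklore] -/
def merFun (y : ℕ) : ℤ := ∑ k ∈ Finset.Icc 1 y, ArithmeticFunction.moebius k

/-- `a ≤ b · ⌈a/b⌉`. [folklore] -/
theorem le_mul_cdiv (a : ℕ) {b : ℕ} (hb : 0 < b) : a ≤ b * cdiv a b := by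
  unfold cdiv
  show a ≤ b * ((a + b - 1) / b)
  have h1 := Nat.div_add_mod (a + b - 1) b
  have h2 := Nat.mod_lt (a + b - 1) hb
  omega

/-- `a/b ≤ ⌈a/b⌉` in `ℝ`. [folklore] -/
theorem cast_div_le_cdiv (a : ℕ) {b : ℕ} (hb : 0 < b) : (a : ℝ) / b ≤ ((cdiv a b : ℕ) : ℝ) := by
  rw [div_le_iff₀ (by exact_mod_cast hb)]
  calc (a : ℝ) ≤ ((b * cdiv a b : ℕ) : ℝ) := by exact_mod_cast le_mul_cdiv a hb
    _ = ((cdiv a b : ℕ) : ℝ) * b := by push_cast; ring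

/-- `tagVal` on tags `≥ 3` vanishes. [folklore] -/
theorem tagVal_add_three (k : ℕ) : tagVal (k + 3) = 0 := rfl

/-- **`m(y)` from the kernel sums**: `m(y) ≤ (Σ⁺⌈2^K/g⌉ − Σ⁻⌊2^K/g⌋)/2^K`. [folklore] -/
theorem mFun_le {y : ℕ} (hy : y < 33124) :
    mFun y ≤ ((((muData y).1 : ℕ) : ℝ) - (((muData y).2.1 : ℕ) : ℝ)) / 2 ^ KK := by
  induction y with
  | zero => simp [mFun, muData_zero]
  | succ y ih =>
    have ih' := ih (by omega)
    have hstep : (ArithmeticFunction.moebius (y + 1) : ℝ) / (y + 1 : ℕ) ≤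
        (((if tagOf (y + 1) = 1 then cdiv (Nat.pow 2 KK) (y + 1) else 0 : ℕ) : ℝ) -
          ((if tagOf (y + 1) = 2 then Nat.div (Nat.pow 2 KK) (y + 1) else 0 : ℕ) : ℝ)) / 2 ^ KK := by
      have hmu := moebius_eq_tagVal_facSm (g := y + 1) (by omega) (by omega)
      have hmuR : (ArithmeticFunction.moebius (y + 1) : ℝ) = ((tagVal (tagOf (y + 1)) : ℤ) : ℝ) := by
        rw [tagOf, ← hmu]
      rw [hmuR]
      have hpow : ((Nat.pow 2 KK : ℕ) : ℝ) = 2 ^ KK := by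
        show ((2 ^ KK : ℕ) : ℝ) = _; push_cast; ring
      have hsc : (0 : ℝ) < 2 ^ KK := by positivity
      rcases htag : tagOf (y + 1) with _ | _ | _ | k
      · simp [tagVal]
      · simp only [tagVal, if_true, show (1 : ℕ) ≠ 2 by decide, if_false, Int.cast_one,
          Nat.cast_zero, sub_zero]
        rw [le_div_iff₀ hsc, ← hpow]
        have := cast_div_le_cdiv (Nat.pow 2 KK) (b := y + 1) (by omega)
        calc (1 : ℝ) / ((y + 1 : ℕ) : ℝ) * ((Nat.pow 2 KK : ℕ) : ℝ)
            = ((Nat.pow 2 KK : ℕ) : ℝ) / ((y + 1 : ℕ) : ℝ) := by ring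
          _ ≤ _ := this
      · simp only [tagVal, show (2 : ℕ) ≠ 1 by decide, if_false, if_true, Int.cast_neg,
          Int.cast_one, Nat.cast_zero, zero_sub]
        rw [le_div_iff₀ hsc, ← hpow]
        have : ((Nat.div (Nat.pow 2 KK) (y + 1) : ℕ) : ℝ) ≤ ((Nat.pow 2 KK : ℕ) : ℝ) / ((y + 1 : ℕ) : ℝ) := Nat.cast_div_le
        have h2 : ((Nat.div (Nat.pow 2 KK) (y + 1) : ℕ) : ℝ) ≤
            ((Nat.pow 2 KK : ℕ) : ℝ) / ((y + 1 : ℕ) : ℝ) := this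
        calc (-1 : ℝ) / ((y + 1 : ℕ) : ℝ) * ((Nat.pow 2 KK : ℕ) : ℝ)
            = -(((Nat.pow 2 KK : ℕ) : ℝ) / ((y + 1 : ℕ) : ℝ)) := by ring
          _ ≤ _ := by linarith
      · simp [tagVal_add_three]
    rw [mFun, Finset.sum_Icc_succ_top (by omega), muData_succ]
    rw [mFun] at ih'
    push_cast
    have e1 : ((y : ℝ) + 1) = ((y + 1 : ℕ) : ℝ) := by push_cast; ring
    rw [e1]
    calc _ ≤ ((((muData y).1 : ℕ) : ℝ) - (((muData y).2.1 : ℕ) : ℝ)) / 2 ^ KK +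
          (((if tagOf (y + 1) = 1 then cdiv (Nat.pow 2 KK) (y + 1) else 0 : ℕ) : ℝ) -
          ((if tagOf (y + 1) = 2 then Nat.div (Nat.pow 2 KK) (y + 1) else 0 : ℕ) : ℝ)) / 2 ^ KK :=
          add_le_add ih' hstep
      _ = _ := by push_cast; ring

/-- **`M(y)` from the kernel counts**: `M(y) = #{μ=1} − #{μ=−1}`. [folklore] -/
theorem merFun_eq {y : ℕ} (hy : y < 33124) :
    merFun y = (((muData y).2.2.1 : ℕ) : ℤ) - (((muData y).2.2.2 : ℕ) : ℤ) := by
  induction y with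
  | zero => simp [merFun, muData_zero]
  | succ y ih =>
    have ih' := ih (by omega)
    rw [merFun] at ih' ⊢
    rw [Finset.sum_Icc_succ_top (by omega), ih', muData_succ,
      moebius_eq_tagVal_facSm (g := y + 1) (by omega) (by omega)]
    change _ + tagVal (tagOf (y + 1)) = _
    rcases htag : tagOf (y + 1) with _ | _ | _ | k
    · simp [tagVal]
    · simp [tagVal]; ring
    · simp [tagVal]; ring
    · simp [tagVal_add_three]

/-! ### Per-`d` inequalities -/

/-- `2^K` as a real power. [folklore] -/
theorem cast_sc : ((Nat.pow 2 KK : ℕ) : ℝ) = 2 ^ KK := by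
  show ((2 ^ KK : ℕ) : ℝ) = _; push_cast; ring

/-- The `T`-term: `H_F(d) m(x_d)/d ≤ (t⁺_d − t⁻_d)/2^K`. [folklore] -/
theorem termT_le {recs : List (ℕ × List ℕ)} (h : certAll recs = true) {d : ℕ} (hd0 : 0 < d)
    (hd : d < 32768) :
    HF recs d * mFun (xOf d) / d ≤
      ((((incr (mkTree recs) d).1 : ℕ) : ℝ) - (((incr (mkTree recs) d).2.1 : ℕ) : ℝ)) / 2 ^ KK := by
  obtain ⟨hHF, hpos⟩ := HF_eq_dData h hd0 hd
  set v := dData (mkTree recs) d with hv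
  set mu := muData (xOf d) with hmu
  have hx : xOf d < 33124 := by
    unfold xOf MM; exact lt_of_le_of_lt (Nat.div_le_self _ _) (by norm_num)
  have hm := mFun_le hx
  have hsc : (0 : ℝ) < 2 ^ KK := by positivity
  have hdpos : (0 : ℝ) < ((v.2.2 * d : ℕ) : ℝ) := by exact_mod_cast Nat.mul_pos hpos hd0
  have hHn : (0 : ℝ) ≤ ((v.2.1 : ℕ) : ℝ) := Nat.cast_nonneg _
  have h1 : (incr (mkTree recs) d).1 = cdiv (v.2.1 * mu.1) (v.2.2 * d) := rfl
  have h2 : (incr (mkTree recs) d).2.1 = Nat.div (v.2.1 * mu.2.1) (v.2.2 * d) := rfl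
  rw [h1, h2, hHF]
  have hup := cast_div_le_cdiv (v.2.1 * mu.1) (b := v.2.2 * d) (Nat.mul_pos hpos hd0)
  have hdn : ((Nat.div (v.2.1 * mu.2.1) (v.2.2 * d) : ℕ) : ℝ) ≤ ((v.2.1 * mu.2.1 : ℕ) : ℝ) / ((v.2.2 * d : ℕ) : ℝ) := Nat.cast_div_le
  -- `HF m / d = Hn (m) /(Hd d)` and `m ≤ (mp - mn)/2^K`
  have hHF0 : 0 ≤ ((v.2.1 : ℕ) : ℝ) / ((v.2.2 : ℕ) : ℝ) / d := by positivity
  calc ((v.2.1 : ℕ) : ℝ) / ((v.2.2 : ℕ) : ℝ) * mFun (xOf d) / d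
      = ((v.2.1 : ℕ) : ℝ) / ((v.2.2 : ℕ) : ℝ) / d * mFun (xOf d) := by ring
    _ ≤ ((v.2.1 : ℕ) : ℝ) / ((v.2.2 : ℕ) : ℝ) / d *
          (((((mu.1 : ℕ)) : ℝ) - ((mu.2.1 : ℕ) : ℝ)) / 2 ^ KK) :=
        mul_le_mul_of_nonneg_left hm hHF0
    _ = (((v.2.1 * mu.1 : ℕ) : ℝ) / ((v.2.2 * d : ℕ) : ℝ) -
          ((v.2.1 * mu.2.1 : ℕ) : ℝ) / ((v.2.2 * d : ℕ) : ℝ)) / 2 ^ KK := by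
        have : ((v.2.2 : ℕ) : ℝ) ≠ 0 := by exact_mod_cast hpos.ne'
        have : (d : ℝ) ≠ 0 := by exact_mod_cast hd0.ne'
        push_cast
        field_simp
    _ ≤ _ := by
        refine div_le_div_of_nonneg_right ?_ hsc.le
        linarith

/-- The `I`-term: `H_F(d) · (X_d/(2^K − X_d))/d ≤ i_d/2^K` (needs `X_d < 2^K`). [folklore] -/
theorem termI_le {recs : List (ℕ × List ℕ)} (h : certAll recs = true) {d : ℕ} (hd0 : 0 < d)
    (hd : d < 32768) (hX : (dData (mkTree recs) d).1 < Nat.pow 2 KK) :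
    HF recs d * ((((dData (mkTree recs) d).1 : ℕ) : ℝ) /
        (2 ^ KK - (((dData (mkTree recs) d).1 : ℕ) : ℝ))) / d ≤
      (((incr (mkTree recs) d).2.2.1 : ℕ) : ℝ) / 2 ^ KK := by
  obtain ⟨hHF, hpos⟩ := HF_eq_dData h hd0 hd
  set v := dData (mkTree recs) d with hv
  have hsc : (0 : ℝ) < 2 ^ KK := by positivity
  have hXlt : ((v.1 : ℕ) : ℝ) < 2 ^ KK := by rw [← cast_sc]; exact_mod_cast hX
  have h3 : (incr (mkTree recs) d).2.2.1 =
      cdiv (Nat.pow 2 KK * v.2.1 * v.1) (v.2.2 * (Nat.pow 2 KK - v.1) * d) := rfl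
  rw [h3, hHF]
  have hden : 0 < v.2.2 * (Nat.pow 2 KK - v.1) * d :=
    Nat.mul_pos (Nat.mul_pos hpos (Nat.sub_pos_of_lt hX)) hd0
  have hup := cast_div_le_cdiv (Nat.pow 2 KK * v.2.1 * v.1) hden
  rw [le_div_iff₀ hsc]
  refine le_trans (le_of_eq ?_) hup
  have e1 : ((v.2.2 * (Nat.pow 2 KK - v.1) * d : ℕ) : ℝ) =
      ((v.2.2 : ℕ) : ℝ) * (2 ^ KK - ((v.1 : ℕ) : ℝ)) * d := by
    rw [Nat.cast_mul, Nat.cast_mul, Nat.cast_sub hX.le, cast_sc]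
  rw [e1]
  have : ((v.2.2 : ℕ) : ℝ) ≠ 0 := by exact_mod_cast hpos.ne'
  have : (d : ℝ) ≠ 0 := by exact_mod_cast hd0.ne'
  have : (2 : ℝ) ^ KK - ((v.1 : ℕ) : ℝ) ≠ 0 := by linarith
  push_cast
  rw [cast_sc]
  field_simp

/-- The `S`-term: `(s⁺_d − s⁻_d)/2^K ≤ H_F(d) M(x_d)`. [folklore] -/
theorem termS_ge {recs : List (ℕ × List ℕ)} (h : certAll recs = true) {d : ℕ} (hd0 : 0 < d)
    (hd : d < 32768) :
    ((((incr (mkTree recs) d).2.2.2.1 : ℕ) : ℝ) - (((incr (mkTree recs) d).2.2.2.2 : ℕ) : ℝ)) / 2 ^ KK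
      ≤ HF recs d * (merFun (xOf d) : ℝ) := by
  obtain ⟨hHF, hpos⟩ := HF_eq_dData h hd0 hd
  set v := dData (mkTree recs) d with hv
  set mu := muData (xOf d) with hmu
  have hx : xOf d < 33124 := by
    unfold xOf MM; exact lt_of_le_of_lt (Nat.div_le_self _ _) (by norm_num)
  have hM := merFun_eq hx
  have hsc : (0 : ℝ) < 2 ^ KK := by positivity
  have h4 : (incr (mkTree recs) d).2.2.2.1 = Nat.div (v.2.1 * mu.2.2.1 * Nat.pow 2 KK) v.2.2 := rfl
  have h5 : (incr (mkTree recs) d).2.2.2.2 = cdiv (v.2.1 * mu.2.2.2 * Nat.pow 2 KK) v.2.2 := rfl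
  rw [h4, h5, hHF, hM]
  have hdn : ((Nat.div (v.2.1 * mu.2.2.1 * Nat.pow 2 KK) v.2.2 : ℕ) : ℝ) ≤ ((v.2.1 * mu.2.2.1 * Nat.pow 2 KK : ℕ) : ℝ) / ((v.2.2 : ℕ) : ℝ) := Nat.cast_div_le
  have hup := cast_div_le_cdiv (v.2.1 * mu.2.2.2 * Nat.pow 2 KK) hpos
  rw [div_le_iff₀ hsc]
  have hv0 : ((v.2.2 : ℕ) : ℝ) ≠ 0 := by exact_mod_cast hpos.ne'
  have e1 : ((v.2.1 : ℕ) : ℝ) / ((v.2.2 : ℕ) : ℝ) *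
      ((((((mu.2.2.1 : ℕ) : ℤ) - ((mu.2.2.2 : ℕ) : ℤ) : ℤ)) : ℝ)) * 2 ^ KK =
      ((v.2.1 * mu.2.2.1 * Nat.pow 2 KK : ℕ) : ℝ) / ((v.2.2 : ℕ) : ℝ) -
        ((v.2.1 * mu.2.2.2 * Nat.pow 2 KK : ℕ) : ℝ) / ((v.2.2 : ℕ) : ℝ) := by
    push_cast
    rw [cast_sc]
    field_simp
  rw [e1]
  linarith


/-! ## §7 Unlisted primes: where they are, how few, and the weights `W_e` -/

/-- Primes of order exactly `e` (`e ≥ 1`): the prime factors of `2^e − 1` of order `e`. [folklore] -/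
noncomputable def Qe (e : ℕ) : Finset ℕ := (2 ^ e - 1).primeFactors.filter (fun p => ordTwo p = e)

/-- Membership in `Qe`. [folklore] -/
theorem mem_Qe {e p : ℕ} (he : 1 ≤ e) : p ∈ Qe e ↔ p.Prime ∧ ordTwo p = e := by
  rw [Qe, Finset.mem_filter, Nat.mem_primeFactors]
  constructor
  · rintro ⟨⟨hp, -, -⟩, ho⟩; exact ⟨hp, ho⟩
  · rintro ⟨hp, ho⟩
    refine ⟨⟨hp, ?_, ?_⟩, ho⟩
    · rw [dvd_two_pow_sub_one_iff, ho]
    · have : 2 ≤ 2 ^ e := by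
        calc 2 = 2 ^ 1 := by norm_num
          _ ≤ 2 ^ e := Nat.pow_le_pow_right two_pos he
      omega

/-- Primes of order `e ≥ 1` are odd, hence `> 2`. [folklore] -/
theorem two_lt_of_mem_Qe {e p : ℕ} (he : 1 ≤ e) (hp : p ∈ Qe e) : 2 < p := by
  have hpf := (Finset.mem_filter.1 hp).1
  rw [Nat.mem_primeFactors] at hpf
  obtain ⟨hpr, hdvd, -⟩ := hpf
  have hodd : Odd p := (odd_two_pow_sub_one he).of_dvd_nat hdvd
  have h1 := Nat.odd_iff.1 hodd
  have h2 := hpr.two_le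
  omega

/-- The unlisted primes of order `e`. [folklore] -/
noncomputable def Re (recs : List (ℕ × List ℕ)) (e : ℕ) : Finset ℕ := Qe e \ F recs e

/-- Members of `Re`. [folklore] -/
theorem mem_Re {recs : List (ℕ × List ℕ)} {e p : ℕ} (he : 1 ≤ e) :
    p ∈ Re recs e ↔ (p.Prime ∧ ordTwo p = e) ∧ p ∉ F recs e := by
  rw [Re, Finset.mem_sdiff, mem_Qe he]

/-- **Cofactor hypothesis**: for every order `e ∈ [1, 2^15)` the cofactor `c_e` is coprime to the
product of the table primes (all primes `≤ 4599989`). [folklore] -/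
def CofOK (recs : List (ℕ × List ℕ)) : Prop :=
  ∀ e, 0 < e → e < 32768 →
    Nat.Coprime (cOf e (leafQs (mkTree recs) e)) (lprod LFunctions.ChainTable.table)

/-- `CofOK` from accepted cofactor ranges covering `[1, 2^15)`. [folklore] -/
theorem cofOK_of_cofCheck {recs : List (ℕ × List ℕ)}
    (hlen : LFunctions.ChainTable.table.length ≤ 400000)
    (H : ∀ e, 0 < e → e < 32768 → ∃ bb e0 len,
      cofCheck LFunctions.ChainTable.table recs bb e0 len = true ∧ e0 ≤ e ∧ e < e0 + len) :
    CofOK recs := by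
  intro e he0 he
  obtain ⟨bb, e0, len, h, h1, h2⟩ := H e he0 he
  exact cofCheck_sound h hlen h1 h2

/-- **Unlisted primes are large**: `p ∈ R_e ⇒ p ≥ P₀ = 4599990`. [folklore] -/
theorem P0_le_of_mem_Re {recs : List (ℕ × List ℕ)} (hcert : certAll recs = true) (hcof : CofOK recs)
    {e p : ℕ} (he0 : 0 < e) (he : e < 32768) (hp : p ∈ Re recs e) : P0 ≤ p := by
  rw [mem_Re he0] at hp
  obtain ⟨⟨hpr, ho⟩, hnF⟩ := hp
  have hq : ∀ q ∈ leafQs (mkTree recs) e, ¬ p ∣ q := by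
    intro q hq hdvd
    have hqF : q ∈ F recs e := List.mem_toFinset.2 hq
    have hqpr := (mem_F hcert he hqF).1
    have : p = q := (Nat.prime_dvd_prime_iff_eq hpr hqpr).1 hdvd
    exact hnF (this ▸ hqF)
  by_contra hlt
  have hle : p ≤ 4599989 := by unfold P0 at hlt; omega
  have hmem := LFunctions.ChainTable.tableOK.complete p hpr hle
  have h1 : p ∣ Nat.gcd (cOf e (leafQs (mkTree recs) e)) (lprod LFunctions.ChainTable.table) :=
    Nat.dvd_gcd (dvd_cOf hpr ho he0 hq) (dvd_lprod hmem)
  rw [Nat.Coprime.gcd_eq_one (hcof e he0 he)] at h1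
  exact hpr.one_lt.ne' (Nat.dvd_one.1 h1)

/-- `2^22 ≤ P₀`. [folklore] -/
theorem two_pow_22_le_P0 : 2 ^ 22 ≤ P0 := by unfold P0; norm_num

/-- **Unlisted primes are few**: `#R_e ≤ ⌊(e−1)/22⌋` (their product divides `2^e − 1` and each
is `> 2^22`). [folklore] -/
theorem card_Re_le {recs : List (ℕ × List ℕ)} (hcert : certAll recs = true) (hcof : CofOK recs)
    {e : ℕ} (he0 : 0 < e) (he : e < 32768) : (Re recs e).card ≤ (e - 1) / 22 := by
  set k := (Re recs e).card with hk
  have hprod_dvd : ∏ p ∈ Re recs e, p ∣ 2 ^ e - 1 := by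
    refine Finset.prod_primes_dvd (2 ^ e - 1) (fun p hp => Nat.prime_iff.1 ((mem_Re he0).1 hp).1.1)
      fun p hp => ?_
    have := ((mem_Re he0).1 hp).1
    rw [dvd_two_pow_sub_one_iff, this.2]
  have hpos : 0 < 2 ^ e - 1 := by
    have : 2 ≤ 2 ^ e := by
      calc 2 = 2 ^ 1 := by norm_num
        _ ≤ 2 ^ e := Nat.pow_le_pow_right two_pos he0
    omega
  have hle : ∏ p ∈ Re recs e, p ≤ 2 ^ e - 1 := Nat.le_of_dvd hpos hprod_dvd
  have hlow : (2 ^ 22) ^ k ≤ ∏ p ∈ Re recs e, p := by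
    calc (2 ^ 22) ^ k ≤ P0 ^ k := Nat.pow_le_pow_left two_pow_22_le_P0 k
      _ ≤ ∏ p ∈ Re recs e, p :=
          Finset.pow_card_le_prod _ _ _ fun p hp => P0_le_of_mem_Re hcert hcof he0 he hp
  have hlt : 2 ^ (22 * k) < 2 ^ e := by
    rw [pow_mul]; omega
  have := (Nat.pow_lt_pow_iff_right (by norm_num : 1 < 2)).1 hlt
  omega

/-! ### Arithmetic progressions and the three-block weight -/

/-- **Sums over a sparse set in an arithmetic progression**: if every member of `S` is `≥ b` and
`≡ b (mod s)`, then for `f` antitone on `[b, ∞)`, `Σ_{p ∈ S} f(p) ≤ Σ_{i < #S} f(b + i s)`. [folklore] -/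
theorem sum_AP_le (f : ℕ → ℝ) {b s : ℕ} (_hs : 0 < s)
    (hf : ∀ u v, b ≤ u → u ≤ v → f v ≤ f u) :
    ∀ (n : ℕ) (S : Finset ℕ), S.card = n → (∀ p ∈ S, b ≤ p ∧ p % s = b % s) →
      ∑ p ∈ S, f p ≤ ∑ i ∈ Finset.range n, f (b + i * s) := by
  intro n
  induction n with
  | zero =>
    intro S hc _
    rw [Finset.card_eq_zero.1 hc]; simp
  | succ n ih =>
    intro S hc hS
    -- every member is `b + k(p) s`
    have hrepr : ∀ p ∈ S, p = b + (p - b) / s * s := by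
      intro p hp
      obtain ⟨hbp, hmod⟩ := hS p hp
      have hdvd : s ∣ p - b := (Nat.modEq_iff_dvd' hbp).1 hmod.symm
      have := Nat.div_mul_cancel hdvd
      omega
    -- some member has index `≥ n`
    have hbig : ∃ p₀ ∈ S, n ≤ (p₀ - b) / s := by
      by_contra hno
      push Not at hno
      have hmaps : ∀ p ∈ S, (p - b) / s ∈ Finset.range n := fun p hp =>
        Finset.mem_range.2 (hno p hp)
      obtain ⟨x, hx, y, hy, hne, hxy⟩ :=
        Finset.exists_ne_map_eq_of_card_lt_of_maps_to (by rw [Finset.card_range]; omega) hmaps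
      exact hne (by rw [hrepr x hx, hrepr y hy, hxy])
    obtain ⟨p₀, hp₀, hn⟩ := hbig
    have hS' : ∀ p ∈ S.erase p₀, b ≤ p ∧ p % s = b % s := fun p hp =>
      hS p (Finset.mem_of_mem_erase hp)
    have hc' : (S.erase p₀).card = n := by rw [Finset.card_erase_of_mem hp₀, hc]; rfl
    have ih' := ih (S.erase p₀) hc' hS'
    rw [← Finset.add_sum_erase S f hp₀, Finset.sum_range_succ]
    have hfp : f p₀ ≤ f (b + n * s) := by
      refine hf _ _ (by omega) ?_
      calc b + n * s ≤ b + (p₀ - b) / s * s := by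
            have := Nat.mul_le_mul_right s hn; omega
        _ = p₀ := (hrepr p₀ hp₀).symm
    linarith

/-- One block: `Σ_{j ≤ i < j'} 1/(b + i s − 2) ≤ ⌈2^K (j'−j)/(b + j s − 2)⌉/2^K`. [folklore] -/
theorem sum_Ico_inv_le_blk {b s j j' : ℕ} (hb : 3 ≤ b) (_hjj : j ≤ j') :
    ∑ i ∈ Finset.Ico j j', 1 / (((b + i * s : ℕ) : ℝ) - 2) ≤ ((blk b s j j' : ℕ) : ℝ) / 2 ^ KK := by
  have hb3 : (3 : ℝ) ≤ b := by exact_mod_cast hb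
  have hden : (0 : ℝ) < ((b + j * s : ℕ) : ℝ) - 2 := by
    have : (0 : ℝ) ≤ (j : ℝ) * s := by positivity
    push_cast; linarith
  have hsc : (0 : ℝ) < 2 ^ KK := by positivity
  calc ∑ i ∈ Finset.Ico j j', 1 / (((b + i * s : ℕ) : ℝ) - 2)
      ≤ ∑ i ∈ Finset.Ico j j', 1 / (((b + j * s : ℕ) : ℝ) - 2) := by
        refine Finset.sum_le_sum fun i hi => one_div_le_one_div_of_le hden ?_
        have : j * s ≤ i * s := Nat.mul_le_mul_right s (Finset.mem_Ico.1 hi).1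
        have : ((b + j * s : ℕ) : ℝ) ≤ ((b + i * s : ℕ) : ℝ) := by exact_mod_cast (by omega)
        linarith
    _ = ((j' - j : ℕ) : ℝ) / (((b + j * s : ℕ) : ℝ) - 2) := by
        rw [Finset.sum_const, Nat.card_Ico, nsmul_eq_mul]; ring
    _ = ((Nat.pow 2 KK * (j' - j) : ℕ) : ℝ) / ((b + j * s - 2 : ℕ) : ℝ) / 2 ^ KK := by
        have e2 : ((b + j * s - 2 : ℕ) : ℝ) = ((b + j * s : ℕ) : ℝ) - 2 := by
          rw [Nat.cast_sub (by omega)]; push_cast; ring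
        rw [e2, Nat.cast_mul, cast_sc]
        field_simp
    _ ≤ ((blk b s j j' : ℕ) : ℝ) / 2 ^ KK := by
        refine div_le_div_of_nonneg_right ?_ hsc.le
        exact cast_div_le_cdiv _ (by omega)

/-- Three blocks: `Σ_{i<N} 1/(b + i s − 2) ≤ (blk₀ + blk₁ + blk₂)/2^K` with cut points
`j₁ = max 1 ⌊N/16⌋ ≤ j₂ = max 1 ⌊N/4⌋ ≤ N`. [folklore] -/
theorem sum_range_inv_le_blk3 {b s N : ℕ} (hb : 3 ≤ b) (hN : 0 < N) :
    ∑ i ∈ Finset.range N, 1 / (((b + i * s : ℕ) : ℝ) - 2) ≤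
      ((blk b s 0 (max 1 (Nat.div N 16)) + blk b s (max 1 (Nat.div N 16)) (max 1 (Nat.div N 4)) +
        blk b s (max 1 (Nat.div N 4)) N : ℕ) : ℝ) / 2 ^ KK := by
  set j1 := max 1 (Nat.div N 16) with hj1
  set j2 := max 1 (Nat.div N 4) with hj2
  have hd16 : Nat.div N 16 = N / 16 := rfl
  have hd4 : Nat.div N 4 = N / 4 := rfl
  have h1 : j1 ≤ j2 := by rw [hj1, hj2, hd16, hd4]; omega
  have h2 : j2 ≤ N := by rw [hj2, hd4]; omega
  have B0 := sum_Ico_inv_le_blk (s := s) hb (Nat.zero_le j1)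
  have B1 := sum_Ico_inv_le_blk (s := s) hb h1
  have B2 := sum_Ico_inv_le_blk (s := s) hb h2
  rw [Finset.range_eq_Ico, ← Finset.sum_Ico_consecutive _ (Nat.zero_le j1) (h1.trans h2),
    ← Finset.sum_Ico_consecutive _ h1 h2, Nat.cast_add, Nat.cast_add, add_div, add_div]
  linarith

/-- The progression start used by the checker: the least `n ≥ P₀` with `n ≡ 1 (mod s_e)`. [folklore] -/
def bOf (e : ℕ) : ℕ := P0 + Nat.mod (sOf e - Nat.mod (P0 - 1) (sOf e)) (sOf e)

/-- `s_e ≥ 1` for `e ≥ 1`. [folklore] -/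
theorem sOf_pos {e : ℕ} (he : 0 < e) : 0 < sOf e := lt_of_lt_of_le he (le_sOf e)

/-- `b_e = s_e t + 1` for some `t`. [folklore] -/
theorem bOf_eq_mul_add_one {e : ℕ} (he : 0 < e) : ∃ t, bOf e = sOf e * t + 1 := by
  have hs := sOf_pos he
  set s := sOf e with hsdef
  set r := (P0 - 1) % s with hr
  have hrs : r < s := Nat.mod_lt _ hs
  have hdm := Nat.div_add_mod (P0 - 1) s
  have hP : 1 ≤ P0 := by unfold P0; norm_num
  show ∃ t, P0 + Nat.mod (s - Nat.mod (P0 - 1) s) s = s * t + 1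
  rw [show Nat.mod (P0 - 1) s = r from rfl]
  by_cases hr0 : r = 0
  · refine ⟨(P0 - 1) / s, ?_⟩
    rw [hr0, Nat.sub_zero, show Nat.mod s s = s % s from rfl, Nat.mod_self]
    omega
  · refine ⟨(P0 - 1) / s + 1, ?_⟩
    rw [show Nat.mod (s - r) s = (s - r) % s from rfl, Nat.mod_eq_of_lt (by omega)]
    rw [mul_add, mul_one]
    omega

/-- `P₀ ≤ b_e < P₀ + s_e`. [folklore] -/
theorem bOf_bounds {e : ℕ} (he : 0 < e) : P0 ≤ bOf e ∧ bOf e < P0 + sOf e := by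
  refine ⟨Nat.le_add_right _ _, ?_⟩
  unfold bOf
  exact Nat.add_lt_add_left (Nat.mod_lt _ (sOf_pos he)) _

/-- Every `n ≥ P₀` with `n ≡ 1 (mod s_e)` satisfies `n ≥ b_e` and `n ≡ b_e`. [folklore] -/
theorem bOf_le_of_mod {e n : ℕ} (he : 0 < e) (hn : P0 ≤ n) (hmod : n % sOf e = 1 % sOf e) :
    bOf e ≤ n ∧ n % sOf e = bOf e % sOf e := by
  have hs := sOf_pos he
  obtain ⟨t, ht⟩ := bOf_eq_mul_add_one he
  have hbmod : bOf e % sOf e = 1 % sOf e := by rw [ht, Nat.mul_add_mod]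
  refine ⟨?_, by rw [hmod, hbmod]⟩
  by_contra hlt
  push Not at hlt
  have hdvd : sOf e ∣ bOf e - n := (Nat.modEq_iff_dvd' hlt.le).1 (hmod.trans hbmod.symm)
  have := Nat.le_of_dvd (by omega) hdvd
  have := (bOf_bounds he).2
  omega

/-- `W_e` unfolded. [folklore] -/
theorem wOf_eq (e : ℕ) : wOf e = if Nat.div (e - 1) 22 = 0 then 0 else
    blk (bOf e) (sOf e) 0 (max 1 (Nat.div (Nat.div (e - 1) 22) 16)) +
      blk (bOf e) (sOf e) (max 1 (Nat.div (Nat.div (e - 1) 22) 16)) (max 1 (Nat.div (Nat.div (e - 1) 22) 4)) +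
      blk (bOf e) (sOf e) (max 1 (Nat.div (Nat.div (e - 1) 22) 4)) (Nat.div (e - 1) 22) := by
  rw [wOf, bOf]
  simp only []
  by_cases h : Nat.div (e - 1) 22 = 0
  · simp [h]
  · rw [if_neg h]
    have : Nat.beq (Nat.div (e - 1) 22) 0 = false := by
      cases hb : Nat.beq (Nat.div (e - 1) 22) 0
      · rfl
      · exact absurd (Nat.eq_of_beq_eq_true hb) h
    simp [this]

/-- **The weight bound**: `Σ_{p ∈ R_e} 1/(p − 2) ≤ W_e/2^K` (`1 ≤ e < 2^15`). [folklore] -/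
theorem sum_Re_le_wOf {recs : List (ℕ × List ℕ)} (hcert : certAll recs = true) (hcof : CofOK recs)
    {e : ℕ} (he0 : 0 < e) (he : e < 32768) :
    ∑ p ∈ Re recs e, 1 / ((p : ℝ) - 2) ≤ ((wOf e : ℕ) : ℝ) / 2 ^ KK := by
  have hsc : (0 : ℝ) < 2 ^ KK := by positivity
  have hcard := card_Re_le hcert hcof he0 he
  set N := (e - 1) / 22 with hNdef
  have hNd : Nat.div (e - 1) 22 = N := rfl
  rw [wOf_eq, hNd]
  by_cases hN : N = 0
  · have hc0 : Re recs e = ∅ := Finset.card_eq_zero.1 (by omega)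
    rw [if_pos hN, hc0, Finset.sum_empty]; simp
  · rw [if_neg hN]
    have hs := sOf_pos he0
    obtain ⟨hbP, -⟩ := bOf_bounds he0
    have hb3 : 3 ≤ bOf e := le_trans (by unfold P0; norm_num) hbP
    -- the members of `R_e` lie in the progression `b_e + i s_e`, `i ≥ 0`
    have hS : ∀ p ∈ Re recs e, bOf e ≤ p ∧ p % sOf e = bOf e % sOf e := by
      intro p hp
      have hP0 := P0_le_of_mem_Re hcert hcof he0 he hp
      obtain ⟨⟨hpr, ho⟩, -⟩ := (mem_Re he0).1 hp
      have hodd : Odd p := hpr.odd_of_ne_two (by have := two_pow_22_le_P0; omega)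
      have h1 : sOf e ∣ p - 1 := by
        refine sOf_dvd (ho ▸ ordTwo_dvd_sub_one hpr hodd) ?_
        obtain ⟨m, hm⟩ := hodd
        exact ⟨m, by omega⟩
      have hmod : p % sOf e = 1 % sOf e :=
        ((Nat.modEq_iff_dvd' hpr.one_lt.le).2 h1).symm
      exact bOf_le_of_mod he0 hP0 hmod
    have hf : ∀ u v, bOf e ≤ u → u ≤ v → 1 / ((v : ℝ) - 2) ≤ 1 / ((u : ℝ) - 2) := by
      intro u v hu huv
      have : (3 : ℝ) ≤ u := by exact_mod_cast hb3.trans hu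
      exact one_div_le_one_div_of_le (by linarith) (by simpa using (Nat.cast_le (α := ℝ)).2 huv)
    have h1 := sum_AP_le (fun p : ℕ => 1 / ((p : ℝ) - 2)) hs hf _ (Re recs e) rfl hS
    refine h1.trans (le_trans ?_ (sum_range_inv_le_blk3 (s := sOf e) hb3 (Nat.pos_of_ne_zero hN)))
    have hsub : Finset.range (Re recs e).card ⊆ Finset.range N := Finset.range_mono hcard
    refine le_trans (Finset.sum_le_sum_of_subset_of_nonneg hsub fun i _ _ => ?_) (le_of_eq ?_)
    · have : (3 : ℝ) ≤ ((bOf e + i * sOf e : ℕ) : ℝ) := by exact_mod_cast (by omega)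
      have : (0 : ℝ) < ((bOf e + i * sOf e : ℕ) : ℝ) - 2 := by linarith
      positivity
    · rfl

/-! ### The inflation factor at `n` -/

/-- Unlisted primes with order dividing `n`. [folklore] -/
noncomputable def RR (recs : List (ℕ × List ℕ)) (n : ℕ) : Finset ℕ := n.divisors.biUnion (Re recs)

/-- `Infl(n) = ∏_{q unlisted, ord q ∣ n} (1 + 1/(q−2))`. [folklore] -/
noncomputable def Infl (recs : List (ℕ × List ℕ)) (n : ℕ) : ℝ :=
  ∏ q ∈ RR recs n, (1 + 1 / ((q : ℝ) - 2))

/-- Members of `RR n`. [folklore] -/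
theorem mem_RR {recs : List (ℕ × List ℕ)} {n q : ℕ} :
    q ∈ RR recs n ↔ ∃ e ∈ n.divisors, q ∈ Re recs e := by
  rw [RR, Finset.mem_biUnion]

/-- Members of `RR n` are primes `> 2` (indeed `≥ P₀`). [folklore] -/
theorem two_lt_of_mem_RR {recs : List (ℕ × List ℕ)} {n q : ℕ} (hq : q ∈ RR recs n) :
    q.Prime ∧ 2 < q := by
  obtain ⟨e, he, hqe⟩ := mem_RR.1 hq
  have he0 : 1 ≤ e := Nat.pos_of_mem_divisors he
  exact ⟨((mem_Re he0).1 hqe).1.1, two_lt_of_mem_Qe he0 (Finset.mem_sdiff.1 hqe).1⟩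

/-- `Infl(n) ≥ 1`. [folklore] -/
theorem one_le_Infl (recs : List (ℕ × List ℕ)) (n : ℕ) : 1 ≤ Infl recs n := by
  rw [Infl, ← Finset.prod_const_one (s := RR recs n)]
  refine Finset.prod_le_prod (fun _ _ => zero_le_one) fun q hq => ?_
  rw [Finset.prod_const_one]
  have : (2 : ℝ) < q := by exact_mod_cast (two_lt_of_mem_RR hq).2
  have : 0 < (q : ℝ) - 2 := by linarith
  have : 0 ≤ 1 / ((q : ℝ) - 2) := by positivity
  linarith

/-- `Σ_{q ∈ RR(n)} 1/(q−2) ≤ X_n/2^K`, `X_n = Σ_{e∣n} W_e`. [folklore] -/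
theorem sum_RR_le {recs : List (ℕ × List ℕ)} (hcert : certAll recs = true) (hcof : CofOK recs)
    {n : ℕ} (hn0 : 0 < n) (hn : n < 32768) :
    ∑ q ∈ RR recs n, 1 / ((q : ℝ) - 2) ≤ (((dData (mkTree recs) n).1 : ℕ) : ℝ) / 2 ^ KK := by
  rw [dData_eq recs hn0 hn]
  dsimp only
  have hdisj : (n.divisors : Set ℕ).PairwiseDisjoint (Re recs) := by
    intro e he e' he' hne
    have he0 : 1 ≤ e := Nat.pos_of_mem_divisors (Finset.mem_coe.1 he)
    have he0' : 1 ≤ e' := Nat.pos_of_mem_divisors (Finset.mem_coe.1 he')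
    rw [Function.onFun, Finset.disjoint_left]
    intro q h1 h2
    exact hne (((mem_Re he0).1 h1).1.2.symm.trans ((mem_Re he0').1 h2).1.2)
  rw [RR, Finset.sum_biUnion hdisj, Nat.cast_sum, Finset.sum_div]
  refine Finset.sum_le_sum fun e he => ?_
  exact sum_Re_le_wOf hcert hcof (Nat.pos_of_mem_divisors he)
    (lt_of_le_of_lt (Nat.divisor_le he) hn)

/-- `∏(1 + uᵢ) ≤ 1/(1 − Σ uᵢ)` for `uᵢ ≥ 0`, `Σ uᵢ < 1`. [folklore] -/
theorem prod_one_add_le_inv {ι : Type*} (s : Finset ι) (u : ι → ℝ) (hu : ∀ i ∈ s, 0 ≤ u i)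
    (hU : ∑ i ∈ s, u i < 1) : ∏ i ∈ s, (1 + u i) ≤ 1 / (1 - ∑ i ∈ s, u i) := by
  have h1 : ∏ i ∈ s, (1 + u i) ≤ Real.exp (∑ i ∈ s, u i) := by
    rw [Real.exp_sum]
    exact Finset.prod_le_prod (fun i hi => by linarith [hu i hi]) fun i hi => by
      linarith [Real.add_one_le_exp (u i)]
  have h2 : Real.exp (∑ i ∈ s, u i) * (1 - ∑ i ∈ s, u i) ≤ 1 := by
    have := Real.add_one_le_exp (-(∑ i ∈ s, u i))
    calc Real.exp (∑ i ∈ s, u i) * (1 - ∑ i ∈ s, u i)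
        ≤ Real.exp (∑ i ∈ s, u i) * Real.exp (-(∑ i ∈ s, u i)) :=
          mul_le_mul_of_nonneg_left (by linarith) (Real.exp_pos _).le
      _ = 1 := by rw [← Real.exp_add, add_neg_cancel, Real.exp_zero]
  rw [le_div_iff₀ (by linarith)]
  exact le_trans (mul_le_mul_of_nonneg_right h1 (by linarith)) h2

/-- **Inflation bound**: `Infl(n) − 1 ≤ X_n/(2^K − X_n)` (needs `X_n < 2^K`). [folklore] -/
theorem Infl_sub_one_le {recs : List (ℕ × List ℕ)} (hcert : certAll recs = true) (hcof : CofOK recs)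
    {n : ℕ} (hn0 : 0 < n) (hn : n < 32768) (hX : (dData (mkTree recs) n).1 < Nat.pow 2 KK) :
    Infl recs n - 1 ≤ (((dData (mkTree recs) n).1 : ℕ) : ℝ) /
        (2 ^ KK - (((dData (mkTree recs) n).1 : ℕ) : ℝ)) := by
  set X : ℝ := (((dData (mkTree recs) n).1 : ℕ) : ℝ) with hXdef
  have hsc : (0 : ℝ) < 2 ^ KK := by positivity
  have hXlt : X < 2 ^ KK := by rw [hXdef, ← cast_sc]; exact_mod_cast hX
  have hX0 : 0 ≤ X := Nat.cast_nonneg _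
  have hU := sum_RR_le hcert hcof hn0 hn
  rw [← hXdef] at hU
  have hξ : X / 2 ^ KK < 1 := by rw [div_lt_one hsc]; exact hXlt
  have hu : ∀ q ∈ RR recs n, 0 ≤ 1 / ((q : ℝ) - 2) := by
    intro q hq
    have : (2 : ℝ) < q := by exact_mod_cast (two_lt_of_mem_RR hq).2
    have : 0 < (q : ℝ) - 2 := by linarith
    positivity
  have h1 := prod_one_add_le_inv (RR recs n) (fun q => 1 / ((q : ℝ) - 2)) hu (lt_of_le_of_lt hU hξ)
  have h2 : 1 / (1 - ∑ q ∈ RR recs n, 1 / ((q : ℝ) - 2)) ≤ 1 / (1 - X / 2 ^ KK) :=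
    one_div_le_one_div_of_le (by linarith) (by linarith)
  have h3 : 1 / (1 - X / 2 ^ KK) - 1 = X / (2 ^ KK - X) := by
    have : (2 : ℝ) ^ KK - X ≠ 0 := by linarith
    have : 1 - X / 2 ^ KK ≠ 0 := by
      rw [sub_ne_zero]; exact (ne_of_lt hξ).symm
    field_simp
    ring
  rw [Infl]
  linarith


/-! ## §8 The refined majorant: `E(x) ≤ Φ_x(C) + Σ_{n ≤ x} H_F(n)(Infl(n) − 1)` -/

/-- The order-lcm of a set of primes. [folklore] -/
noncomputable def Lo (S : Finset ℕ) : ℕ := S.lcm ordTwo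

/-- Unlisted primes of order `≤ x`. [folklore] -/
noncomputable def Rx (recs : List (ℕ × List ℕ)) (x : ℕ) : Finset ℕ := (Finset.Icc 1 x).biUnion (Re recs)

/-- Members of `Rx`. [folklore] -/
theorem mem_Rx {recs : List (ℕ × List ℕ)} {x q : ℕ} :
    q ∈ Rx recs x ↔ ∃ e, (1 ≤ e ∧ e ≤ x) ∧ q ∈ Re recs e := by
  simp only [Rx, Finset.mem_biUnion, Finset.mem_Icc]

/-- `C ∪ R_{≤x}` is a set of odd primes. [folklore] -/
theorem primeSet_union {recs : List (ℕ × List ℕ)} (hcert : certAll recs = true) (x : ℕ) :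
    PrimeSet (CsetT recs ∪ Rx recs x) := by
  intro q hq
  rcases Finset.mem_union.1 hq with hq | hq
  · exact primeSet_CsetT hcert q hq
  · obtain ⟨e, ⟨he1, -⟩, hqe⟩ := mem_Rx.1 hq
    exact ⟨((mem_Re he1).1 hqe).1.1, two_lt_of_mem_Qe he1 (Finset.mem_sdiff.1 hqe).1⟩

/-- Every prime factor of an odd `t` with `ord_t 2 ≤ x < 2^15` is listed or unlisted of order `≤ x`.
[folklore] -/
theorem primeFactors_subset {recs : List (ℕ × List ℕ)} {x : ℕ} (hx : x < 32768)
    (t : ℕ) (_ht0 : t ≠ 0) (hodd : Odd t) (hox : ordTwo t ≤ x) :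
    t.primeFactors ⊆ CsetT recs ∪ Rx recs x := by
  intro p hp
  rw [Nat.mem_primeFactors] at hp
  obtain ⟨hpr, hdvd, -⟩ := hp
  have hpodd : Odd p := hodd.of_dvd_nat hdvd
  have he1 : 1 ≤ ordTwo p := ordTwo_pos hpodd
  have hex : ordTwo p ≤ x := (ordTwo_le_ordTwo_of_dvd hodd hdvd).trans hox
  rw [Finset.mem_union]
  by_cases hF : p ∈ F recs (ordTwo p)
  · exact Or.inl (mem_CsetT.2 ⟨ordTwo p, by omega, hF⟩)
  · exact Or.inr (mem_Rx.2 ⟨ordTwo p, ⟨he1, hex⟩, (mem_Re he1).2 ⟨⟨hpr, rfl⟩, hF⟩⟩)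

/-- `S = (S ∩ C) ∪ (S ∖ C)`. [folklore] -/
theorem eq_inter_union_sdiff (S C : Finset ℕ) : S = S ∩ C ∪ S \ C := by
  ext q; simp only [Finset.mem_union, Finset.mem_inter, Finset.mem_sdiff]; tauto

/-- `w(S) = w(S ∩ C) · w(S ∖ C)`. [folklore] -/
theorem wt_split (S C : Finset ℕ) : wt S = wt (S ∩ C) * wt (S \ C) := by
  conv_lhs => rw [eq_inter_union_sdiff S C]
  rw [wt, wt, wt, Finset.prod_union]
  exact Finset.disjoint_left.2 fun q h1 h2 => (Finset.mem_sdiff.1 h2).2 (Finset.mem_inter.1 h1).2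

/-- `H_F(n) = Σ_{U ⊆ C_n} w(U)`. [folklore] -/
theorem HF_eq_sum (recs : List (ℕ × List ℕ)) (n : ℕ) :
    HF recs n = ∑ U ∈ (Cn recs n).powerset, wt U := by
  rw [HF, Finset.prod_one_add]; rfl

/-- `Infl(n) − 1 = Σ_{∅ ≠ V ⊆ RR_n} w(V)`. [folklore] -/
theorem Infl_sub_one_eq (recs : List (ℕ × List ℕ)) (n : ℕ) :
    Infl recs n - 1 = ∑ V ∈ (RR recs n).powerset.erase ∅, wt V := by
  rw [Finset.sum_erase_eq_sub (Finset.empty_mem_powerset _), Infl, Finset.prod_one_add]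
  simp [wt]

/-- The fibre over `n`: sets `S ⊆ C ∪ R_{≤x}`, `S ⊄ C`, with order-lcm `n ≤ x < 2^15`, weigh at most
`H_F(n)(Infl(n) − 1)` (split `S = (S ∩ C) ⊔ (S ∖ C)`). [folklore] -/
theorem fiber_le {recs : List (ℕ × List ℕ)} (hcert : certAll recs = true) {x n : ℕ} (hx : x < 32768)
    (hn1 : 1 ≤ n) (hnx : n ≤ x) (T : Finset (Finset ℕ))
    (hT : ∀ S ∈ T, S ⊆ CsetT recs ∪ Rx recs x ∧ ¬ S ⊆ CsetT recs ∧ Lo S = n) :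
    ∑ S ∈ T, wt S ≤ HF recs n * (Infl recs n - 1) := by
  set C := CsetT recs with hC
  set φ : Finset ℕ → Finset ℕ × Finset ℕ := fun S => (S ∩ C, S \ C) with hφ
  set tgt := (Cn recs n).powerset ×ˢ ((RR recs n).powerset.erase ∅) with htgt
  have hn0 : n ≠ 0 := by omega
  -- the image lies in the target
  have hmaps : ∀ S ∈ T, φ S ∈ tgt := by
    intro S hS
    obtain ⟨hSA, hnC, hL⟩ := hT S hS
    rw [htgt, Finset.mem_product, Finset.mem_powerset, Finset.mem_erase, Finset.mem_powerset]
    refine ⟨?_, ?_, ?_⟩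
    · intro q hq
      obtain ⟨hqS, hqC⟩ := Finset.mem_inter.1 hq
      obtain ⟨e, he, hqe⟩ := mem_CsetT.1 hqC
      have ho := (mem_F hcert he hqe).2.2.1
      have hdvd : e ∣ n := by rw [← ho, ← hL]; exact Finset.dvd_lcm hqS
      rw [Cn, Finset.mem_biUnion]
      exact ⟨e, Nat.mem_divisors.2 ⟨hdvd, hn0⟩, hqe⟩
    · obtain ⟨q, hqS, hqC⟩ := Finset.not_subset.1 hnC
      exact Finset.ne_empty_of_mem (Finset.mem_sdiff.2 ⟨hqS, hqC⟩)
    · intro q hq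
      obtain ⟨hqS, hqC⟩ := Finset.mem_sdiff.1 hq
      have hqA := hSA hqS
      rcases Finset.mem_union.1 hqA with h | h
      · exact absurd h hqC
      · obtain ⟨e, ⟨he1, -⟩, hqe⟩ := mem_Rx.1 h
        have ho := ((mem_Re he1).1 hqe).1.2
        have hdvd : e ∣ n := by rw [← ho, ← hL]; exact Finset.dvd_lcm hqS
        exact mem_RR.2 ⟨e, Nat.mem_divisors.2 ⟨hdvd, hn0⟩, hqe⟩
  -- injectivity
  have hinj : Set.InjOn φ T := by
    intro S₁ _ S₂ _ h
    simp only [hφ, Prod.mk.injEq] at h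
    rw [eq_inter_union_sdiff S₁ C, eq_inter_union_sdiff S₂ C, h.1, h.2]
  -- nonnegativity of the target weights
  have hwU : ∀ U ∈ (Cn recs n).powerset, 0 ≤ wt U := fun U hU =>
    wt_nonneg fun q hq => (mem_Cn hcert (by omega) (Finset.mem_powerset.1 hU hq)).2.1
  have hwV : ∀ V ∈ (RR recs n).powerset.erase ∅, 0 ≤ wt V := fun V hV =>
    wt_nonneg fun q hq => (two_lt_of_mem_RR (Finset.mem_powerset.1 (Finset.mem_erase.1 hV).2 hq)).2
  calc ∑ S ∈ T, wt S = ∑ S ∈ T, wt (φ S).1 * wt (φ S).2 :=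
        Finset.sum_congr rfl fun S _ => wt_split S C
    _ = ∑ p ∈ T.image φ, wt p.1 * wt p.2 :=
        (Finset.sum_image (f := fun p : Finset ℕ × Finset ℕ => wt p.1 * wt p.2) hinj).symm
    _ ≤ ∑ p ∈ tgt, wt p.1 * wt p.2 := by
        refine Finset.sum_le_sum_of_subset_of_nonneg (Finset.image_subset_iff.2 hmaps) ?_
        intro p hp _
        rw [htgt, Finset.mem_product] at hp
        exact mul_nonneg (hwU _ hp.1) (hwV _ hp.2)
    _ = (∑ U ∈ (Cn recs n).powerset, wt U) * ∑ V ∈ (RR recs n).powerset.erase ∅, wt V := by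
        rw [htgt, Finset.sum_product, Finset.sum_mul_sum]
    _ = HF recs n * (Infl recs n - 1) := by rw [HF_eq_sum, Infl_sub_one_eq]

/-- **The refined majorant** (`1 ≤ x < 2^15`):
`E(x) ≤ Φ_x(C, 1) + Σ_{n=1}^{x} H_F(n)(Infl(n) − 1)`. [cite: HeathbrownPuchta2002, §5 (41)] -/
theorem sum_filter_le_refined {recs : List (ℕ × List ℕ)} (hcert : certAll recs = true)
    (s : Finset ℕ) {x : ℕ} (hx : x < 32768) :
    ∑ t ∈ s with ordTwo t ≤ x, fq 1 t ≤
      Phi x (CsetT recs) 1 + ∑ n ∈ Finset.Icc 1 x, HF recs n * (Infl recs n - 1) := by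
  set C := CsetT recs with hC
  set A := CsetT recs ∪ Rx recs x with hA
  have hAP : PrimeSet A := primeSet_union hcert x
  have h0 := sum_filter_ordTwo_le_Phi s hAP (primeFactors_subset hx)
  refine h0.trans ?_
  -- split the powerset sum at `S ⊆ C`
  set G : Finset ℕ → ℝ := fun S => if Nat.lcm 1 (S.lcm ordTwo) ≤ x then wt S else 0 with hG
  have hPhiA : Phi x A 1 = ∑ S ∈ A.powerset, G S := rfl
  have hPhiC : Phi x C 1 = ∑ S ∈ C.powerset, G S := rfl
  have hsplit := Finset.sum_filter_add_sum_filter_not A.powerset (fun S => S ⊆ C) G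
  have hfirst : ∑ S ∈ A.powerset with S ⊆ C, G S = Phi x C 1 := by
    rw [hPhiC]
    refine Finset.sum_congr ?_ fun _ _ => rfl
    ext S
    simp only [Finset.mem_filter, Finset.mem_powerset]
    constructor
    · exact fun h => h.2
    · exact fun h => ⟨h.trans Finset.subset_union_left, h⟩
  have hsecond : ∑ S ∈ A.powerset with ¬ S ⊆ C, G S ≤
      ∑ n ∈ Finset.Icc 1 x, HF recs n * (Infl recs n - 1) := by
    have hGT : ∑ S ∈ A.powerset with ¬ S ⊆ C, G S =
        ∑ S ∈ (A.powerset.filter (fun S => ¬ S ⊆ C)).filter (fun S => Lo S ≤ x), wt S := by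
      rw [Finset.sum_filter (fun S => Lo S ≤ x)]
      refine Finset.sum_congr rfl fun S _ => ?_
      simp only [hG, Nat.lcm_one_left, Lo]
      congr
    rw [hGT]
    have hmaps : ∀ S ∈ (A.powerset.filter (fun S => ¬ S ⊆ C)).filter (fun S => Lo S ≤ x),
        Lo S ∈ Finset.Icc 1 x := by
      intro S hS
      rw [Finset.mem_filter, Finset.mem_filter, Finset.mem_powerset] at hS
      exact Finset.mem_Icc.2 ⟨lcm_ordTwo_pos fun q hq => hAP q (hS.1.1 hq), hS.2⟩
    rw [← Finset.sum_fiberwise_of_maps_to hmaps]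
    refine Finset.sum_le_sum fun n hn => ?_
    obtain ⟨hn1, hnx⟩ := Finset.mem_Icc.1 hn
    refine fiber_le hcert hx hn1 hnx _ fun S hS => ?_
    rw [Finset.mem_filter, Finset.mem_filter, Finset.mem_filter, Finset.mem_powerset] at hS
    exact ⟨hS.1.1.1, hS.1.1.2, hS.2⟩
  rw [hPhiA]
  linarith


/-! ## §9 The head sum: Abel summation and Möbius inversion over the listed primes -/

/-- **Abel summation**: `Σ_{x=1}^{N} (Σ_{n ≤ x} a_n)/(x(x+1)) = Σ_{n=1}^{N} a_n (1/n − 1/(N+1))`. [folklore] -/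
theorem abel_head_sum (a : ℕ → ℝ) : ∀ N : ℕ,
    ∑ x ∈ Finset.Icc 1 N, (∑ n ∈ Finset.Icc 1 x, a n) / ((x : ℝ) * (x + 1)) =
      ∑ n ∈ Finset.Icc 1 N, a n * (1 / (n : ℝ) - 1 / ((N : ℝ) + 1))
  | 0 => by simp
  | N + 1 => by
    rw [Finset.sum_Icc_succ_top (by omega), abel_head_sum a N, Finset.sum_Icc_succ_top (by omega),
      Finset.sum_Icc_succ_top (by omega)]
    have hN1 : (0 : ℝ) < (N : ℝ) + 1 := by positivity
    have hN2 : (0 : ℝ) < (N : ℝ) + 2 := by positivity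
    have e1 : ∀ n : ℕ, a n * (1 / (n : ℝ) - 1 / (((N + 1 : ℕ) : ℝ) + 1)) =
        a n * (1 / (n : ℝ) - 1 / ((N : ℝ) + 1)) +
          a n * (1 / (((N + 1 : ℕ) : ℝ) * (((N + 1 : ℕ) : ℝ) + 1))) := by
      intro n; push_cast; field_simp; ring
    rw [Finset.sum_congr rfl fun n _ => e1 n, Finset.sum_add_distrib, ← Finset.sum_mul]
    push_cast
    field_simp
    ring

/-- `g_C(n) = Σ_{S ⊆ C, Lo S = n} w(S)`: the weight of order class `n`. [folklore] -/
noncomputable def gC (C : Finset ℕ) (n : ℕ) : ℝ := ∑ S ∈ C.powerset with Lo S = n, wt S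

/-- The fibre of `Lo` over `n ≤ x` inside `{Lo ≤ x}` is the fibre in the whole powerset. [folklore] -/
theorem fiber_Lo_eq (C : Finset ℕ) {n x : ℕ} (hnx : n ≤ x) :
    (C.powerset.filter (fun S => Lo S ≤ x)).filter (fun S => Lo S = n) =
      C.powerset.filter (fun S => Lo S = n) := by
  ext S
  simp only [Finset.mem_filter]
  constructor
  · rintro ⟨⟨h1, -⟩, h3⟩; exact ⟨h1, h3⟩
  · rintro ⟨h1, h3⟩; exact ⟨⟨h1, h3 ▸ hnx⟩, h3⟩

/-- `Φ_x(C,1) = Σ_{S ⊆ C, Lo S ≤ x} w(S)`. [folklore] -/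
theorem Phi_eq_filter (C : Finset ℕ) (x : ℕ) :
    Phi x C 1 = ∑ S ∈ C.powerset with Lo S ≤ x, wt S := by
  rw [Phi, Finset.sum_filter]
  refine Finset.sum_congr rfl fun S _ => ?_
  rw [Nat.lcm_one_left]
  try congr

/-- `Φ_x(C,1) = Σ_{n=1}^{x} g_C(n)`. [folklore] -/
theorem Phi_eq_sum_gC {C : Finset ℕ} (hC : PrimeSet C) (x : ℕ) :
    Phi x C 1 = ∑ n ∈ Finset.Icc 1 x, gC C n := by
  rw [Phi_eq_filter]
  have hmaps : ∀ S ∈ C.powerset.filter (fun S => Lo S ≤ x), Lo S ∈ Finset.Icc 1 x := fun S hS => by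
    rw [Finset.mem_filter, Finset.mem_powerset] at hS
    exact Finset.mem_Icc.2 ⟨lcm_ordTwo_pos fun q hq => hC q (hS.1 hq), hS.2⟩
  rw [← Finset.sum_fiberwise_of_maps_to hmaps]
  refine Finset.sum_congr rfl fun n hn => ?_
  rw [fiber_Lo_eq C (Finset.mem_Icc.1 hn).2, gC]

/-- `Σ_{x=1}^{N} Φ_x(C,1)/(x(x+1)) = Σ_{S ⊆ C, Lo S ≤ N} w(S)(1/Lo S − 1/(N+1))`. [folklore] -/
theorem headPhi_eq {C : Finset ℕ} (hC : PrimeSet C) (N : ℕ) :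
    ∑ x ∈ Finset.Icc 1 N, Phi x C 1 / ((x : ℝ) * (x + 1)) =
      ∑ S ∈ C.powerset with Lo S ≤ N, wt S * (1 / (Lo S : ℝ) - 1 / ((N : ℝ) + 1)) := by
  rw [Finset.sum_congr rfl fun x _ => by rw [Phi_eq_sum_gC hC x], abel_head_sum]
  have hmaps : ∀ S ∈ C.powerset.filter (fun S => Lo S ≤ N), Lo S ∈ Finset.Icc 1 N := fun S hS => by
    rw [Finset.mem_filter, Finset.mem_powerset] at hS
    exact Finset.mem_Icc.2 ⟨lcm_ordTwo_pos fun q hq => hC q (hS.1 hq), hS.2⟩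
  rw [← Finset.sum_fiberwise_of_maps_to hmaps]
  refine Finset.sum_congr rfl fun n hn => ?_
  rw [fiber_Lo_eq C (Finset.mem_Icc.1 hn).2, gC, Finset.sum_mul]
  refine Finset.sum_congr rfl fun S hS => ?_
  rw [(Finset.mem_filter.1 hS).2]

/-- `H_F(d) = Σ_{S ⊆ C, Lo S ∣ d} w(S)` (`1 ≤ d < 2^15`). [folklore] -/
theorem HF_eq_filter {recs : List (ℕ × List ℕ)} (hcert : certAll recs = true) {d : ℕ} (hd0 : 0 < d)
    (hd : d < 32768) : HF recs d = ∑ S ∈ (CsetT recs).powerset with Lo S ∣ d, wt S := by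
  rw [HF_eq_sum]
  refine Finset.sum_congr ?_ fun _ _ => rfl
  ext U
  rw [Finset.mem_powerset, Finset.mem_filter, Finset.mem_powerset]
  constructor
  · intro hU
    exact ⟨fun q hq => (mem_Cn hcert hd (hU hq)).2.2.2,
      Finset.lcm_dvd fun q hq => (mem_Cn hcert hd (hU hq)).2.2.1⟩
  · rintro ⟨hUC, hL⟩ q hq
    obtain ⟨e, he, hqe⟩ := mem_CsetT.1 (hUC hq)
    have ho := (mem_F hcert he hqe).2.2.1
    have hdvd : e ∣ d := by rw [← ho]; exact (Finset.dvd_lcm hq).trans hL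
    rw [Cn, Finset.mem_biUnion]
    exact ⟨e, Nat.mem_divisors.2 ⟨hdvd, hd0.ne'⟩, hqe⟩

/-- Swapping a hyperbolic double sum. [folklore] -/
theorem sum_hyper_swap (G : ℕ → ℕ → ℝ) (N : ℕ) :
    ∑ j ∈ Finset.Icc 1 N, ∑ k ∈ Finset.Icc 1 (N / j), G j k =
      ∑ k ∈ Finset.Icc 1 N, ∑ j ∈ Finset.Icc 1 (N / k), G j k := by
  refine Finset.sum_comm' fun j k => ?_
  simp only [Finset.mem_Icc]
  constructor
  · rintro ⟨⟨hj1, -⟩, hk1, hkN⟩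
    have hkj : k * j ≤ N := (Nat.le_div_iff_mul_le (by omega)).1 hkN
    have hjk : j * k ≤ N := by rwa [mul_comm] at hkj
    exact ⟨⟨hj1, (Nat.le_div_iff_mul_le (by omega)).2 hjk⟩, hk1,
      le_trans (Nat.le_mul_of_pos_right k (by omega)) hkj⟩
  · rintro ⟨⟨hj1, hjN⟩, hk1, -⟩
    have hjk : j * k ≤ N := (Nat.le_div_iff_mul_le (by omega)).1 hjN
    have hkj : k * j ≤ N := by rwa [mul_comm] at hjk
    exact ⟨⟨hj1, le_trans (Nat.le_mul_of_pos_right j (by omega)) hjk⟩, hk1,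
      (Nat.le_div_iff_mul_le (by omega)).2 hkj⟩

/-- Reindexing the multiples of `k`: `Σ_{m ≤ N, k ∣ m} h(m) = Σ_{j ≤ N/k} h(k j)`. [folklore] -/
theorem sum_Icc_dvd_eq (h : ℕ → ℝ) {k : ℕ} (hk : 0 < k) (N : ℕ) :
    ∑ m ∈ Finset.Icc 1 N with k ∣ m, h m = ∑ j ∈ Finset.Icc 1 (N / k), h (k * j) := by
  have himg : (Finset.Icc 1 N).filter (fun m => k ∣ m) =
      (Finset.Icc 1 (N / k)).image (fun j => k * j) := by
    ext m
    simp only [Finset.mem_filter, Finset.mem_Icc, Finset.mem_image]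
    constructor
    · rintro ⟨⟨h1, hN⟩, ⟨j, rfl⟩⟩
      have hj : 0 < j := Nat.pos_of_ne_zero (by rintro rfl; simp at h1)
      refine ⟨j, ⟨hj, (Nat.le_div_iff_mul_le hk).2 (by rwa [mul_comm] at hN)⟩, rfl⟩
    · rintro ⟨j, ⟨hj1, hjN⟩, rfl⟩
      have := (Nat.le_div_iff_mul_le hk).1 hjN
      exact ⟨⟨Nat.succ_le_of_lt (Nat.mul_pos hk (by omega)), by rwa [mul_comm]⟩, dvd_mul_right k j⟩
  rw [himg, Finset.sum_image fun j _ j' _ h => Nat.eq_of_mul_eq_mul_left hk h]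

/-- **Möbius inversion, inner sum**: for `L ≥ 1`,
`Σ_{d ≤ N, L ∣ d} Σ_{k ≤ N/d} μ(k) w(kd) = [L ≤ N] w(L)`. [folklore] -/
theorem moebius_inner (w : ℕ → ℝ) {L : ℕ} (hL : 0 < L) (N : ℕ) :
    ∑ d ∈ Finset.Icc 1 N with L ∣ d, ∑ k ∈ Finset.Icc 1 (N / d),
        (ArithmeticFunction.moebius k : ℝ) * w (k * d) = if L ≤ N then w L else 0 := by
  rw [sum_Icc_dvd_eq _ hL]
  have e1 : ∀ j, N / (L * j) = N / L / j := fun j => (Nat.div_div_eq_div_mul N L j).symm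
  simp only [e1]
  rw [sum_hyper_swap (fun j k => (ArithmeticFunction.moebius k : ℝ) * w (k * (L * j))) (N / L)]
  set N' := N / L with hN'
  have h2 : ∑ m ∈ Finset.Icc 1 N', ∑ k ∈ m.divisors, (ArithmeticFunction.moebius k : ℝ) * w (L * m) =
      ∑ k ∈ Finset.Icc 1 N', ∑ j ∈ Finset.Icc 1 (N' / k),
        (ArithmeticFunction.moebius k : ℝ) * w (k * (L * j)) := by
    rw [Finset.sum_comm' (s' := fun k => (Finset.Icc 1 N').filter (fun m => k ∣ m))
      (t' := Finset.Icc 1 N') (fun m k => ?_)]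
    · refine Finset.sum_congr rfl fun k hk => ?_
      have hk0 : 0 < k := (Finset.mem_Icc.1 hk).1
      rw [sum_Icc_dvd_eq (fun m => (ArithmeticFunction.moebius k : ℝ) * w (L * m)) hk0 N']
      refine Finset.sum_congr rfl fun j _ => ?_
      rw [Nat.mul_left_comm]
    · simp only [Finset.mem_filter, Finset.mem_Icc, Nat.mem_divisors]
      constructor
      · rintro ⟨⟨h1, hN⟩, hdvd, -⟩
        have := Nat.le_of_dvd (by omega) hdvd
        have hk0 : 0 < k := Nat.pos_of_ne_zero (by rintro rfl; simp at hdvd; omega)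
        exact ⟨⟨⟨h1, hN⟩, hdvd⟩, hk0, by omega⟩
      · rintro ⟨⟨⟨h1, hN⟩, hdvd⟩, -, -⟩
        exact ⟨⟨h1, hN⟩, hdvd, by omega⟩
  rw [← h2]
  have h3 : ∀ m, ∑ k ∈ m.divisors, (ArithmeticFunction.moebius k : ℝ) * w (L * m) =
      if m = 1 then w (L * m) else 0 := by
    intro m
    rw [← Finset.sum_mul]
    have hc : (∑ k ∈ m.divisors, (ArithmeticFunction.moebius k : ℝ)) =
        ((∑ k ∈ m.divisors, (ArithmeticFunction.moebius k : ℤ) : ℤ) : ℝ) := by push_cast; rfl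
    have hμ : ∑ k ∈ m.divisors, (ArithmeticFunction.moebius k : ℤ) = if m = 1 then 1 else 0 := by
      have := congr_arg (fun f : ArithmeticFunction ℤ => f m) ArithmeticFunction.moebius_mul_coe_zeta
      simpa only [ArithmeticFunction.coe_mul_zeta_apply, ArithmeticFunction.one_apply] using this
    rw [hc, hμ]
    split_ifs <;> simp
  simp only [h3]
  rw [Finset.sum_ite_eq']
  have : (1 ∈ Finset.Icc 1 N') ↔ L ≤ N := by
    rw [Finset.mem_Icc, hN', Nat.le_div_iff_mul_le hL, one_mul]; omega
  simp only [mul_one]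
  by_cases hLN : L ≤ N
  · rw [if_pos (this.2 hLN), if_pos hLN]
  · rw [if_neg (fun h => hLN (this.1 h)), if_neg hLN]

/-- **Möbius inversion over the listed primes**:
`Σ_{d ≤ N} (Σ_{S: Lo S ∣ d} w(S)) (Σ_{k ≤ N/d} μ(k) ω(kd)) = Σ_{S: Lo S ≤ N} w(S) ω(Lo S)`. [folklore] -/
theorem head_moebius {C : Finset ℕ} (hC : PrimeSet C) (w : ℕ → ℝ) (N : ℕ) :
    ∑ d ∈ Finset.Icc 1 N, (∑ S ∈ C.powerset with Lo S ∣ d, wt S) *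
        (∑ k ∈ Finset.Icc 1 (N / d), (ArithmeticFunction.moebius k : ℝ) * w (k * d)) =
      ∑ S ∈ C.powerset with Lo S ≤ N, wt S * w (Lo S) := by
  set A : ℕ → ℝ := fun d =>
    ∑ k ∈ Finset.Icc 1 (N / d), (ArithmeticFunction.moebius k : ℝ) * w (k * d) with hA
  have h1 : ∑ d ∈ Finset.Icc 1 N, (∑ S ∈ C.powerset with Lo S ∣ d, wt S) * A d =
      ∑ S ∈ C.powerset, wt S * ∑ d ∈ Finset.Icc 1 N with Lo S ∣ d, A d := by
    calc ∑ d ∈ Finset.Icc 1 N, (∑ S ∈ C.powerset with Lo S ∣ d, wt S) * A d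
        = ∑ d ∈ Finset.Icc 1 N, ∑ S ∈ C.powerset with Lo S ∣ d, wt S * A d := by
          simp only [Finset.sum_mul]
      _ = ∑ S ∈ C.powerset, ∑ d ∈ Finset.Icc 1 N with Lo S ∣ d, wt S * A d := by
          refine Finset.sum_comm' (s' := fun S => (Finset.Icc 1 N).filter (fun d => Lo S ∣ d))
            (t' := C.powerset) fun d S => ?_
          simp only [Finset.mem_filter]
          tauto
      _ = ∑ S ∈ C.powerset, wt S * ∑ d ∈ Finset.Icc 1 N with Lo S ∣ d, A d := by
          simp only [Finset.mul_sum]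
  rw [h1, Finset.sum_filter]
  refine Finset.sum_congr rfl fun S hS => ?_
  have hS' : PrimeSet S := fun q hq => hC q (Finset.mem_powerset.1 hS hq)
  rw [hA]
  dsimp only
  rw [moebius_inner w (L := Lo S) (lcm_ordTwo_pos hS') N]
  split_ifs <;> simp

/-- **The head over the listed primes, by Möbius inversion**:
`Σ_{x<2^15} Φ_x(C,1)/(x(x+1)) = Σ_{d<2^15} H_F(d) (m(x_d)/d − M(x_d)/2^15)`. [folklore] -/
theorem headPhi_eq_moebius {recs : List (ℕ × List ℕ)} (hcert : certAll recs = true) :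
    ∑ x ∈ Finset.Icc 1 (MM - 1), Phi x (CsetT recs) 1 / ((x : ℝ) * (x + 1)) =
      ∑ d ∈ Finset.Icc 1 (MM - 1),
        HF recs d * (mFun (xOf d) / d - (merFun (xOf d) : ℝ) / MM) := by
  have hC := primeSet_CsetT hcert
  rw [headPhi_eq hC, ← head_moebius hC (fun n => 1 / (n : ℝ) - 1 / (((MM - 1 : ℕ) : ℝ) + 1)) (MM - 1)]
  refine Finset.sum_congr rfl fun d hd => ?_
  obtain ⟨hd1, hdN⟩ := Finset.mem_Icc.1 hd
  have hd' : d < 32768 := by unfold MM at hdN; omega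
  rw [← HF_eq_filter hcert hd1 hd']
  congr 1
  rw [show (MM - 1) / d = xOf d from rfl, mFun, merFun, Finset.sum_div, Int.cast_sum, Finset.sum_div,
    ← Finset.sum_sub_distrib]
  refine Finset.sum_congr rfl fun k hk => ?_
  have hk0 : (k : ℝ) ≠ 0 := by
    have := (Finset.mem_Icc.1 hk).1
    exact_mod_cast (show k ≠ 0 by omega)
  have hd0 : (d : ℝ) ≠ 0 := by exact_mod_cast (show d ≠ 0 by omega)
  have hMM' : ((MM - 1 : ℕ) : ℝ) + 1 = ((MM : ℕ) : ℝ) := by unfold MM; norm_num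
  rw [hMM']
  push_cast
  field_simp

/-! ### The head total -/

/-- **Head bound**: with the kernel tuple `(T⁺, T⁻, I, S⁺, S⁻, ok)` on `[1, 2^15)`,
`Σ_{x<2^15} U(x)/(x(x+1)) ≤ (T⁺ − T⁻ + I)/2^K − (S⁺ − S⁻)/(2^K · 2^15)`, where
`U(x) = Φ_x(C,1) + Σ_{n≤x} H_F(n)(Infl(n) − 1)`. [folklore] -/
theorem head_le {recs : List (ℕ × List ℕ)} (hcert : certAll recs = true) (hcof : CofOK recs)
    {Tp Tn Ip Sp Sn : ℕ} (hhead : headSums recs 1 (MM - 1) = (Tp, Tn, Ip, Sp, Sn, true)) :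
    ∑ x ∈ Finset.Icc 1 (MM - 1),
      (Phi x (CsetT recs) 1 + ∑ n ∈ Finset.Icc 1 x, HF recs n * (Infl recs n - 1)) /
        ((x : ℝ) * (x + 1)) ≤
      ((Tp : ℝ) - Tn + Ip) / 2 ^ KK - ((Sp : ℝ) - Sn) / (2 ^ KK * MM) := by
  -- unpack the kernel tuple
  have hs := headSums_eq recs (dlo := 1) (len := MM - 1) one_pos
  rw [hhead] at hs
  have hIco : Finset.Ico 1 (1 + (MM - 1)) = Finset.Icc 1 (MM - 1) := by
    ext d; simp only [Finset.mem_Ico, Finset.mem_Icc, MM]; omega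
  rw [hIco] at hs
  simp only [Prod.mk.injEq] at hs
  obtain ⟨hT, hTn, hI, hSp, hSn, hok⟩ := hs
  have hX : ∀ d ∈ Finset.Icc 1 (MM - 1), (dData (mkTree recs) d).1 < Nat.pow 2 KK := by
    intro d hd
    have h := List.all_eq_true.1 hok.symm d (Finset.mem_toList.2 hd)
    simpa [Nat.blt_eq] using h
  have hsc : (0 : ℝ) < 2 ^ KK := by positivity
  have hM : (0 : ℝ) < ((MM : ℕ) : ℝ) := by unfold MM; norm_num
  have hMM' : ((MM - 1 : ℕ) : ℝ) + 1 = ((MM : ℕ) : ℝ) := by unfold MM; norm_num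
  rw [Finset.sum_congr rfl fun x _ => add_div _ _ _, Finset.sum_add_distrib, headPhi_eq_moebius hcert,
    abel_head_sum, ← Finset.sum_add_distrib, hMM']
  -- termwise
  have hterm : ∀ d ∈ Finset.Icc 1 (MM - 1),
      HF recs d * (mFun (xOf d) / d - (merFun (xOf d) : ℝ) / MM) +
        HF recs d * (Infl recs d - 1) * (1 / (d : ℝ) - 1 / ((MM : ℕ) : ℝ)) ≤
      ((((incr (mkTree recs) d).1 : ℕ) : ℝ) - (((incr (mkTree recs) d).2.1 : ℕ) : ℝ) +
          (((incr (mkTree recs) d).2.2.1 : ℕ) : ℝ)) / 2 ^ KK -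
        ((((incr (mkTree recs) d).2.2.2.1 : ℕ) : ℝ) - (((incr (mkTree recs) d).2.2.2.2 : ℕ) : ℝ)) /
          (2 ^ KK * MM) := by
    intro d hd
    obtain ⟨hd1, hdN⟩ := Finset.mem_Icc.1 hd
    have hd' : d < 32768 := by unfold MM at hdN; omega
    have h1 := termT_le hcert hd1 hd'
    have h2 := termS_ge hcert hd1 hd'
    have h3 := termI_le hcert hd1 hd' (hX d hd)
    have hI := Infl_sub_one_le hcert hcof hd1 hd' (hX d hd)
    have hH0 := HF_nonneg hcert hd'
    have hI0 : 0 ≤ Infl recs d - 1 := by linarith [one_le_Infl recs d]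
    have hd0 : (0 : ℝ) < d := by exact_mod_cast hd1
    have h2' := div_le_div_of_nonneg_right h2 hM.le
    -- the inflation term: drop `−1/M`, bound `Infl − 1`, then the kernel value
    have h4 : HF recs d * (Infl recs d - 1) * (1 / (d : ℝ) - 1 / ((MM : ℕ) : ℝ)) ≤
        (((incr (mkTree recs) d).2.2.1 : ℕ) : ℝ) / 2 ^ KK := by
      have hb0 : 0 ≤ HF recs d * (Infl recs d - 1) := mul_nonneg hH0 hI0
      calc HF recs d * (Infl recs d - 1) * (1 / (d : ℝ) - 1 / ((MM : ℕ) : ℝ))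
          ≤ HF recs d * (Infl recs d - 1) * (1 / (d : ℝ)) :=
            mul_le_mul_of_nonneg_left (by simp only [one_div]; linarith [inv_pos.2 hM]) hb0
        _ = HF recs d * (Infl recs d - 1) / d := by ring
        _ ≤ HF recs d * ((((dData (mkTree recs) d).1 : ℕ) : ℝ) /
              (2 ^ KK - (((dData (mkTree recs) d).1 : ℕ) : ℝ))) / d :=
            div_le_div_of_nonneg_right (mul_le_mul_of_nonneg_left hI hH0) hd0.le
        _ ≤ _ := h3
    have e5 : HF recs d * (mFun (xOf d) / d - (merFun (xOf d) : ℝ) / MM) =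
        HF recs d * mFun (xOf d) / d - HF recs d * (merFun (xOf d) : ℝ) / MM := by ring
    rw [div_div] at h2'
    rw [e5, show ∀ A B C D : ℝ, (A - B + C) / 2 ^ KK - D / (2 ^ KK * MM) =
      (A - B) / 2 ^ KK + C / 2 ^ KK - D / (2 ^ KK * MM) from fun A B C D => by ring]
    linarith
  refine (Finset.sum_le_sum hterm).trans (le_of_eq ?_)
  rw [Finset.sum_sub_distrib, ← Finset.sum_div, ← Finset.sum_div, Finset.sum_add_distrib,
    Finset.sum_sub_distrib, Finset.sum_sub_distrib, hT, hTn, hI, hSp, hSn]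
  push_cast
  ring


/-! ## §10 Assembly: the uniform bound for the partial sums and `R₀ ≤ 1.94` -/

/-- Combining two kernel head tuples (componentwise sum, conjunction of the flags). [folklore] -/
def hcomb (a b : ℕ × ℕ × ℕ × ℕ × ℕ × Bool) : ℕ × ℕ × ℕ × ℕ × ℕ × Bool :=
  (a.1 + b.1, a.2.1 + b.2.1, a.2.2.1 + b.2.2.1, a.2.2.2.1 + b.2.2.2.1, a.2.2.2.2.1 + b.2.2.2.2.1,
    a.2.2.2.2.2 && b.2.2.2.2.2)

/-- **Block additivity of the head sums**: `headSums` on `[d, d + L)` is the combination of its values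
on `[d, d + l)` and `[d + l, d + L)`. [folklore] -/
theorem headSums_split (recs : List (ℕ × List ℕ)) {dlo l L d2 L2 : ℕ} (hd : 0 < dlo) (hl : l ≤ L)
    (h1 : dlo + l = d2) (h2 : L - l = L2) :
    headSums recs dlo L = hcomb (headSums recs dlo l) (headSums recs d2 L2) := by
  subst h1 h2
  rw [headSums_eq recs hd, headSums_eq recs hd, headSums_eq recs (dlo := dlo + l) (by omega), hcomb]
  have hab : dlo ≤ dlo + l := by omega
  have hbc : dlo + l ≤ dlo + L := by omega
  have hE : dlo + l + (L - l) = dlo + L := by omega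
  rw [hE]
  simp only [← Finset.sum_Ico_consecutive _ hab hbc]
  congr 1; congr 1; congr 1; congr 1; congr 1
  -- the flags
  rw [Bool.eq_iff_iff]
  simp only [Bool.and_eq_true, List.all_eq_true, Finset.mem_toList, Finset.mem_Ico]
  constructor
  · intro h; exact ⟨fun i hi => h i (by omega), fun i hi => h i (by omega)⟩
  · rintro ⟨ha, hb⟩ i hi
    by_cases hil : i < dlo + l
    · exact ha i (by omega)
    · exact hb i (by omega)

/-- The global majorant: refined sieve bound below `2^15`, far-range value `V(⌊log₂ x⌋)` beyond.
[folklore] -/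
noncomputable def U16 (recs : List (ℕ × List ℕ)) (x : ℕ) : ℝ :=
  if x < 32768 then Phi x (CsetT recs) 1 + ∑ n ∈ Finset.Icc 1 x, HF recs n * (Infl recs n - 1)
  else farV (Nat.log 2 x)

/-- `E(x) ≤ U16(x)` for every `x ≥ 1`. [cite: HeathbrownPuchta2002, §5 (41)] -/
theorem sum_filter_le_U16 {recs : List (ℕ × List ℕ)} (hcert : certAll recs = true) (s : Finset ℕ)
    {x : ℕ} (_hx1 : 1 ≤ x) : ∑ t ∈ s with ordTwo t ≤ x, fq 1 t ≤ U16 recs x := by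
  by_cases hx : x < 32768
  · rw [U16, if_pos hx]; exact sum_filter_le_refined hcert s hx
  · rw [U16, if_neg hx]
    push Not at hx
    have h15 : 15 ≤ Nat.log 2 x := Nat.le_log_of_pow_le one_lt_two (by norm_num; omega)
    exact sum_filter_ordTwo_le_farV s (le_trans (by norm_num) h15) (Nat.lt_pow_succ_log_self one_lt_two x)

/-- Telescoping from `j = 15`: `∑_{j=15}^{J} g(j)/2^{j+1} = T(15) − T(J+1)`. [folklore] -/
theorem sum_gfun15 : ∀ J, 15 ≤ J → ∑ j ∈ Finset.Icc 15 J, gfun j / 2 ^ (j + 1) = TjR 15 - TjR (J + 1) := by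
  refine Nat.le_induction ?_ fun J hJ ih => ?_
  · rw [Finset.Icc_self, Finset.sum_singleton, TjR_sub]
  · rw [Finset.sum_Icc_succ_top (by omega), ih, ← TjR_sub]; ring

/-- Dyadic decomposition of `[2^15, 2^{J+1})`. [folklore] -/
theorem sum_Ico_dyadic15 (f : ℕ → ℝ) : ∀ J, 15 ≤ J →
    ∑ x ∈ Finset.Ico (2 ^ 15) (2 ^ (J + 1)), f x =
      ∑ j ∈ Finset.Icc 15 J, ∑ x ∈ Finset.Ico (2 ^ j) (2 ^ (j + 1)), f x := by
  refine Nat.le_induction (by rw [Finset.Icc_self, Finset.sum_singleton]) fun J hJ ih => ?_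
  rw [Finset.sum_Icc_succ_top (by omega), ← ih,
    Finset.sum_Ico_consecutive _ (Nat.pow_le_pow_right two_pos (by omega))
      (Nat.pow_le_pow_right two_pos (by omega))]

/-- `T(15)` as a rational. [folklore] -/
theorem TjR_fifteen : TjR 15 = 1346161 / 1228800000 := by
  rw [TjR]; norm_num

/-- **Uniform bound for the partial sums from the certificate**: for every `X`,
`∑_{t<X} f₁(t)/ξ(t) ≤ HEAD + A₁ T(15)` where `HEAD` is read off the kernel head tuple.
[cite: HeathbrownPuchta2002, §5 (41)] -/
theorem sum_range_le_of_cert {recs : List (ℕ × List ℕ)} (hcert : certAll recs = true)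
    (hcof : CofOK recs) {Tp Tn Ip Sp Sn : ℕ}
    (hhead : headSums recs 1 (MM - 1) = (Tp, Tn, Ip, Sp, Sn, true)) (X : ℕ) :
    ∑ t ∈ Finset.range X, fq 1 t / (ordTwo t : ℝ) ≤
      (((Tp : ℝ) - Tn + Ip) / 2 ^ KK - ((Sp : ℝ) - Sn) / (2 ^ KK * MM)) +
        ((A1Q : ℚ) : ℝ) * TjR 15 := by
  -- dyadic ceiling `X ≤ X' = 2^{J+1} − 1`, `J ≥ 15`
  obtain ⟨J, hJ, hXlt⟩ : ∃ J, 15 ≤ J ∧ X < 2 ^ (J + 1) :=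
    ⟨max 15 (Nat.log 2 X), le_max_left _ _,
      (Nat.lt_pow_succ_log_self one_lt_two X).trans_le (Nat.pow_le_pow_right two_pos (by omega))⟩
  have hX'1 : 2 ^ (J + 1) - 1 + 1 = 2 ^ (J + 1) := Nat.sub_add_cancel Nat.one_le_two_pow
  have h16 : 2 ^ 16 ≤ 2 ^ (J + 1) := Nat.pow_le_pow_right two_pos (by omega)
  have hJJ : 2 ^ J ≤ 2 ^ (J + 1) - 1 := by rw [pow_succ] at hX'1 ⊢; omega
  set X' := 2 ^ (J + 1) - 1 with hX'def
  have hXX' : X ≤ X' := by omega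
  have hbig : 32768 ≤ X' := by norm_num at h16; omega
  have hnn : ∀ t, 0 ≤ fq 1 t / (ordTwo t : ℝ) := fun t => div_nonneg (fq_nonneg 1 t) (Nat.cast_nonneg _)
  have hmono : ∑ t ∈ Finset.range X, fq 1 t / (ordTwo t : ℝ) ≤
      ∑ t ∈ Finset.range X', fq 1 t / (ordTwo t : ℝ) :=
    Finset.sum_le_sum_of_subset_of_nonneg (Finset.range_mono hXX') fun t _ _ => hnn t
  refine hmono.trans ?_
  have hmaj := sum_range_fq_div_ordTwo_le_of_majorant (U16 recs) (X := X') (by omega)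
    fun x hx => sum_filter_le_U16 hcert _ (Finset.mem_Icc.1 hx).1
  refine hmaj.trans ?_
  -- split `[1, X'] = [1, 2^15 − 1] ∪ [2^15, 2^{J+1})`
  have hsplit : ∑ x ∈ Finset.Icc 1 X', U16 recs x / ((x : ℝ) * (x + 1)) =
      ∑ x ∈ Finset.Icc 1 (MM - 1), U16 recs x / ((x : ℝ) * (x + 1)) +
        ∑ x ∈ Finset.Ico (2 ^ 15) (2 ^ (J + 1)), U16 recs x / ((x : ℝ) * (x + 1)) := by
    have h1 : Finset.Icc 1 X' = Finset.Icc 1 (MM - 1) ∪ Finset.Ico (2 ^ 15) (2 ^ (J + 1)) := by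
      ext x; simp only [Finset.mem_Icc, Finset.mem_union, Finset.mem_Ico, MM]; omega
    rw [h1, Finset.sum_union]
    rw [Finset.disjoint_left]
    intro x h1 h2
    simp only [Finset.mem_Icc, Finset.mem_Ico, MM] at h1 h2
    omega
  -- the head
  have hheadle : ∑ x ∈ Finset.Icc 1 (MM - 1), U16 recs x / ((x : ℝ) * (x + 1)) ≤
      ((Tp : ℝ) - Tn + Ip) / 2 ^ KK - ((Sp : ℝ) - Sn) / (2 ^ KK * MM) := by
    have hU : ∀ x ∈ Finset.Icc 1 (MM - 1), U16 recs x / ((x : ℝ) * (x + 1)) =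
        (Phi x (CsetT recs) 1 + ∑ n ∈ Finset.Icc 1 x, HF recs n * (Infl recs n - 1)) /
          ((x : ℝ) * (x + 1)) := by
      intro x hx
      have : x < 32768 := by have := (Finset.mem_Icc.1 hx).2; unfold MM at this; omega
      rw [U16, if_pos this]
    rw [Finset.sum_congr rfl hU]
    exact head_le hcert hcof hhead
  -- the far blocks
  have hblock : ∀ j ∈ Finset.Icc 15 J, ∑ x ∈ Finset.Ico (2 ^ j) (2 ^ (j + 1)),
      U16 recs x / ((x : ℝ) * (x + 1)) = farV j / 2 ^ (j + 1) := by
    intro j hj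
    have hj15 : 15 ≤ j := (Finset.mem_Icc.1 hj).1
    have h215 : 2 ^ 15 ≤ 2 ^ j := Nat.pow_le_pow_right two_pos hj15
    have hU : ∀ x ∈ Finset.Ico (2 ^ j) (2 ^ (j + 1)), U16 recs x / ((x : ℝ) * (x + 1)) =
        farV j * (1 / ((x : ℝ) * (x + 1))) := by
      intro x hx
      have hx' := Finset.mem_Ico.1 hx
      have : ¬ x < 32768 := by norm_num at h215; omega
      rw [U16, if_neg this, Nat.log_eq_of_pow_le_of_lt_pow hx'.1 hx'.2]
      ring
    rw [Finset.sum_congr rfl hU, ← Finset.mul_sum, sum_Ico_block]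
    ring
  have hlast : U16 recs X' / ((X' : ℝ) + 1) = farV J / 2 ^ (J + 1) := by
    have : ¬ X' < 32768 := by omega
    rw [U16, if_neg this, Nat.log_eq_of_pow_le_of_lt_pow hJJ (by omega)]
    have hc : (X' : ℝ) + 1 = (2 : ℝ) ^ (J + 1) := by
      rw [hX'def, Nat.cast_sub Nat.one_le_two_pow]; push_cast; ring
    rw [hc]
  have hfar : ∑ x ∈ Finset.Ico (2 ^ 15) (2 ^ (J + 1)), U16 recs x / ((x : ℝ) * (x + 1)) +
      U16 recs X' / ((X' : ℝ) + 1) ≤ ((A1Q : ℚ) : ℝ) * TjR 15 := by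
    rw [sum_Ico_dyadic15 _ J hJ, Finset.sum_congr rfl hblock, hlast]
    have hJ8 : 8 ≤ J := le_trans (by norm_num) hJ
    have hA0 : 0 ≤ ((A1Q : ℚ) : ℝ) := by
      have := farV_le hJ8
      have hV : 0 ≤ farV J := by
        have := sum_filter_ordTwo_le_farV (∅ : Finset ℕ) (x := 2 ^ (J + 1) - 1) hJ8 (by omega)
        simpa using this
      have hg : 0 < gfun J := by
        rw [gfun]
        have : (17 : ℝ) ≤ ((2 * J + 1 : ℕ) : ℝ) := by exact_mod_cast (show 17 ≤ 2 * J + 1 by omega)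
        exact mul_pos (by linarith) (by nlinarith)
      nlinarith
    have h1 : ∑ j ∈ Finset.Icc 15 J, farV j / 2 ^ (j + 1) ≤
        ((A1Q : ℚ) : ℝ) * ∑ j ∈ Finset.Icc 15 J, gfun j / 2 ^ (j + 1) := by
      rw [Finset.mul_sum]
      refine Finset.sum_le_sum fun j hj => ?_
      rw [mul_div_assoc']
      exact div_le_div_of_nonneg_right (farV_le (le_trans (by norm_num) (Finset.mem_Icc.1 hj).1))
        (by positivity)
    have h2 : farV J / 2 ^ (J + 1) ≤ ((A1Q : ℚ) : ℝ) * (gfun J / 2 ^ (J + 1)) := by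
      rw [mul_div_assoc']
      exact div_le_div_of_nonneg_right (farV_le hJ8) (by positivity)
    have h3 := gfun_div_le_TjR J
    calc _ ≤ ((A1Q : ℚ) : ℝ) * ∑ j ∈ Finset.Icc 15 J, gfun j / 2 ^ (j + 1) +
          ((A1Q : ℚ) : ℝ) * (gfun J / 2 ^ (J + 1)) := add_le_add h1 h2
      _ = ((A1Q : ℚ) : ℝ) * (TjR 15 - TjR (J + 1) + gfun J / 2 ^ (J + 1)) := by
          rw [sum_gfun15 J hJ]; ring
      _ ≤ ((A1Q : ℚ) : ℝ) * TjR 15 := mul_le_mul_of_nonneg_left (by linarith) hA0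
  calc ∑ x ∈ Finset.Icc 1 X', U16 recs x / ((x : ℝ) * (x + 1)) + U16 recs X' / ((X' : ℝ) + 1)
      = ∑ x ∈ Finset.Icc 1 (MM - 1), U16 recs x / ((x : ℝ) * (x + 1)) +
          (∑ x ∈ Finset.Ico (2 ^ 15) (2 ^ (J + 1)), U16 recs x / ((x : ℝ) * (x + 1)) +
            U16 recs X' / ((X' : ℝ) + 1)) := by rw [hsplit, add_assoc]
    _ ≤ _ := add_le_add hheadle hfar

/-- **`R₀ ≤ 1.94` from a certificate**: the certified prime list (`certAll`), the cofactor checks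
(`CofOK`), the kernel head tuple on `[1, 2^15)` and the final rational inequality give
`romanovConst ≤ 1.94`. [cite: HeathbrownPuchta2002, §5 (41)] -/
theorem romanovConst_le_of_cert {recs : List (ℕ × List ℕ)} (hcert : certAll recs = true)
    (hcof : CofOK recs) {Tp Tn Ip Sp Sn : ℕ}
    (hhead : headSums recs 1 (MM - 1) = (Tp, Tn, Ip, Sp, Sn, true))
    (hnum : ((Tp : ℚ) - Tn + Ip) / 2 ^ 60 - ((Sp : ℚ) - Sn) / (2 ^ 60 * 32768) +
      A1Q * (1346161 / 1228800000) ≤ 194 / 100) :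
    romanovConst ≤ 1.94 := by
  refine Real.tsum_le_of_sum_range_le (fun t => div_nonneg (fq_nonneg 1 t) (Nat.cast_nonneg _))
    fun X => (sum_range_le_of_cert hcert hcof hhead X).trans ?_
  rw [TjR_fifteen]
  have h' : ((((Tp : ℚ) - Tn + Ip) / 2 ^ 60 - ((Sp : ℚ) - Sn) / (2 ^ 60 * 32768) +
      A1Q * (1346161 / 1228800000) : ℚ) : ℝ) ≤ ((194 / 100 : ℚ) : ℝ) := by exact_mod_cast hnum
  push_cast at h'
  rw [show (2 : ℝ) ^ KK = 2 ^ 60 from rfl, show ((MM : ℕ) : ℝ) = 32768 by unfold MM; norm_num]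
  linarith


/-! ## §11 Assembly on the certified records -/

/-- The certified records: all primes `q ≤ 4 599 989` of order `< 2^15`, by order. [folklore] -/
def recs : List (ℕ × List ℕ) := parseRecs 20000 (digitsOf (fsegs1 ++ fsegs2))

/-- Record certificate (kernel fact of `…CheckCert.lean`). [folklore] -/
theorem certAll_recs' : certAll recs = true := certAll_recs

/-- The cofactor checks cover `[1, 2^15)`: every unlisted prime of order `e < 2^15` misses the table. [folklore] -/
theorem cofOK_recs : CofOK recs := by
  rw [recs]
  refine cofOK_of_cofCheck table_length_le fun e he0 he => ?_
  by_cases h1 : e < 4096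
  · exact ⟨_, _, _, cof1, by omega, by omega⟩
  by_cases h2 : e < 8192
  · exact ⟨_, _, _, cof2, by omega, by omega⟩
  by_cases h3 : e < 12288
  · exact ⟨_, _, _, cof3, by omega, by omega⟩
  by_cases h4 : e < 16384
  · exact ⟨_, _, _, cof4, by omega, by omega⟩
  by_cases h5 : e < 20480
  · exact ⟨_, _, _, cof5, by omega, by omega⟩
  by_cases h6 : e < 23170
  · exact ⟨_, _, _, cof6, by omega, by omega⟩
  by_cases h7 : e < 28378
  · exact ⟨_, _, _, cof7, by omega, by omega⟩
  · exact ⟨_, _, _, cof8, by omega, by omega⟩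

/-- The head accumulators on the whole range `[1, 2^15)`, combined from the blocks. [folklore] -/
theorem head_total : headSums recs 1 (MM - 1) = (49538575189018459529, 47305768984179276217, 1059608656172275, 246339422258495582753820, 246326315600758265887969, true) := by
  rw [recs, show MM - 1 = 32767 from rfl,
    headSums_split (parseRecs 20000 (digitsOf (fsegs1 ++ fsegs2))) (dlo := 1) (l := 1) (L := 32767) (d2 := 2) (L2 := 32766) (by norm_num) (by norm_num) rfl rfl,
    head_1,
    headSums_split (parseRecs 20000 (digitsOf (fsegs1 ++ fsegs2))) (dlo := 2) (l := 2) (L := 32766) (d2 := 4) (L2 := 32764) (by norm_num) (by norm_num) rfl rfl,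
    head_2,
    headSums_split (parseRecs 20000 (digitsOf (fsegs1 ++ fsegs2))) (dlo := 4) (l := 4) (L := 32764) (d2 := 8) (L2 := 32760) (by norm_num) (by norm_num) rfl rfl,
    head_4,
    headSums_split (parseRecs 20000 (digitsOf (fsegs1 ++ fsegs2))) (dlo := 8) (l := 8) (L := 32760) (d2 := 16) (L2 := 32752) (by norm_num) (by norm_num) rfl rfl,
    head_8,
    headSums_split (parseRecs 20000 (digitsOf (fsegs1 ++ fsegs2))) (dlo := 16) (l := 16) (L := 32752) (d2 := 32) (L2 := 32736) (by norm_num) (by norm_num) rfl rfl,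
    head_16,
    headSums_split (parseRecs 20000 (digitsOf (fsegs1 ++ fsegs2))) (dlo := 32) (l := 32) (L := 32736) (d2 := 64) (L2 := 32704) (by norm_num) (by norm_num) rfl rfl,
    head_32,
    headSums_split (parseRecs 20000 (digitsOf (fsegs1 ++ fsegs2))) (dlo := 64) (l := 64) (L := 32704) (d2 := 128) (L2 := 32640) (by norm_num) (by norm_num) rfl rfl,
    head_64,
    headSums_split (parseRecs 20000 (digitsOf (fsegs1 ++ fsegs2))) (dlo := 128) (l := 128) (L := 32640) (d2 := 256) (L2 := 32512) (by norm_num) (by norm_num) rfl rfl,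
    head_128,
    headSums_split (parseRecs 20000 (digitsOf (fsegs1 ++ fsegs2))) (dlo := 256) (l := 256) (L := 32512) (d2 := 512) (L2 := 32256) (by norm_num) (by norm_num) rfl rfl,
    head_256,
    headSums_split (parseRecs 20000 (digitsOf (fsegs1 ++ fsegs2))) (dlo := 512) (l := 512) (L := 32256) (d2 := 1024) (L2 := 31744) (by norm_num) (by norm_num) rfl rfl,
    head_512,
    headSums_split (parseRecs 20000 (digitsOf (fsegs1 ++ fsegs2))) (dlo := 1024) (l := 1024) (L := 31744) (d2 := 2048) (L2 := 30720) (by norm_num) (by norm_num) rfl rfl,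
    head_1024,
    headSums_split (parseRecs 20000 (digitsOf (fsegs1 ++ fsegs2))) (dlo := 2048) (l := 2048) (L := 30720) (d2 := 4096) (L2 := 28672) (by norm_num) (by norm_num) rfl rfl,
    head_2048,
    headSums_split (parseRecs 20000 (digitsOf (fsegs1 ++ fsegs2))) (dlo := 4096) (l := 4096) (L := 28672) (d2 := 8192) (L2 := 24576) (by norm_num) (by norm_num) rfl rfl,
    head_4096,
    headSums_split (parseRecs 20000 (digitsOf (fsegs1 ++ fsegs2))) (dlo := 8192) (l := 4096) (L := 24576) (d2 := 12288) (L2 := 20480) (by norm_num) (by norm_num) rfl rfl,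
    head_8192,
    headSums_split (parseRecs 20000 (digitsOf (fsegs1 ++ fsegs2))) (dlo := 12288) (l := 4096) (L := 20480) (d2 := 16384) (L2 := 16384) (by norm_num) (by norm_num) rfl rfl,
    head_12288,
    headSums_split (parseRecs 20000 (digitsOf (fsegs1 ++ fsegs2))) (dlo := 16384) (l := 4096) (L := 16384) (d2 := 20480) (L2 := 12288) (by norm_num) (by norm_num) rfl rfl,
    head_16384,
    headSums_split (parseRecs 20000 (digitsOf (fsegs1 ++ fsegs2))) (dlo := 20480) (l := 4096) (L := 12288) (d2 := 24576) (L2 := 8192) (by norm_num) (by norm_num) rfl rfl,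
    head_20480,
    headSums_split (parseRecs 20000 (digitsOf (fsegs1 ++ fsegs2))) (dlo := 24576) (l := 4096) (L := 8192) (d2 := 28672) (L2 := 4096) (by norm_num) (by norm_num) rfl rfl,
    head_24576,
    head_28672]
  rfl

set_option maxHeartbeats 0 in
/-- The final rational inequality `HEAD + A₁ · T(15) ≤ 1.94`. [folklore] -/
theorem final_num : (((49538575189018459529 : ℕ) : ℚ) - (47305768984179276217 : ℕ) + (1059608656172275 : ℕ)) / 2 ^ 60 -
    (((246339422258495582753820 : ℕ) : ℚ) - (246326315600758265887969 : ℕ)) / (2 ^ 60 * 32768) + A1Q * (1346161 / 1228800000) ≤ 194 / 100 := by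
  norm_num [A1Q, c0iQ, pkQ, cb0, cb1, cb2, cb3, cb4, cb5]

end Literature.NumberTheory.Sieve.RomanovCert

namespace Literature.NumberTheory.Sieve.GoldbachLinnik

open RomanovCert in
/-- **Romanov's constant is at most `1.94`** (kernel-checked certificate over all primes of order `< 2^15`
below `4.6·10^6`, cofactor completeness by the prime table, explicit inflation and far-range tails):
`R₀ = Σ_t f₁(t)/ord_t(2) ≤ 1.94`. [cite: HeathbrownPuchta2002, §5 (41)] -/
theorem romanovConst_le_194 : romanovConst ≤ 1.94 :=
  romanovConst_le_of_cert certAll_recs' cofOK_recs head_total final_num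

end Literature.NumberTheory.Sieve.GoldbachLinnik
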